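import Literature.Combinatorics.AssociationSchemes.JohnsonHarmonics
import HarnessLib

/-!
# The spectrum of the Johnson scheme by the ladder calculus

Source followed: F. J. MacWilliams, N. J. A. Sloane, *The Theory of Error-Correcting Codes*
(North-Holland 1977), Ch. 21 §6 "The Johnson scheme" [MacWilliamsSloane1977] (held text:
`book:macwilliamsnd-theory-error-correcting-codes`, PDF p. 516): the association scheme on the `t`-subsets
`U` of an `n`-set (there: binary vectors of length `l = n` and weight `n = t`), `U, U'` being `i`-th
associates iff `|U ∩ U'| = t − i`; **Theorem 10** (Delsarte; Yamamoto–Fujii–Hamada): the eigenvalues of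
the scheme are `p_k(i) = E_k(i)`, the Eberlein polynomials, on the common eigenspaces
`V_0, …, V_t` of the Bose–Mesner algebra; **Theorem 11 (iv)**: `E_1(x) = t(n−t) − x(n+1−x)` and the
three-term recurrence; **Problem (11)**: with `A_i` the `t`-sets × `i`-sets inclusion matrix,
`C_i = A_i A_iᵀ = Σ_k C(k, i) D_{t−k}` — the "binomial kernels" `C(|U ∩ U'|, i)` form a basis of the
Bose–Mesner algebra. (Proofs: P. Delsarte, *An algebraic approach to the association schemes of
coding theory*, Philips Res. Rep. Suppl. 10 (1973), §4.2 [Delsarte1973].)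

WHAT IS FORMALISED — the spectral theorem in the currency of the tree's ladder calculus
(`Literature.Combinatorics.AssociationSchemes.JohnsonHarmonics`: raising `up = Wᵀ`, lowering
`down = W`, harmonic vectors `IsHarmonic j p` = homogeneous of degree `j` and killed by `down`; the
eigenspace `V_j` of the book is realised as the ladder `up^[t−j] (Ker W_j)`), everything PROVED:
* §1 iterated lowering of a ladder: `down^[s] (up^[m] p) = (Π_{r<s} λ_j(m−1−r)) • up^[m−s] p` for
  harmonic `p` of degree `j` and `s ≤ m` (`iterate_down_iterate_up_of_isHarmonic`; `= 0` for `s > m`),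
  hence `up^[s] ∘ down^[s]` is a SCALAR on every ladder (`iterate_up_down_ladder`);
* §2 the kernel of `up^[s] ∘ down^[s]` on `L_t` (MS Problem (11), `C_{t−s} = A_{t−s} A_{t−s}ᵀ`):
  `(up^[s] (down^[s] v)) U = (s!)² Σ_{|U'| = t} C(|U ∩ U'|, t − s) v(U')`
  (`iterate_up_iterate_down_apply`), via the explicit formula for `down^[s]`
  (`iterate_down_apply_of_isHomog`) dual to the tree's `iterate_up_apply_of_isHomog`;
* §3 hence every binomial kernel `C(|U ∩ U'|, a)` acts on the ladder `up^[t−j] p` by the explicit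
  scalar `binomEigen n t j a` (`binomKernel_ladder`), and — expanding an arbitrary kernel
  `k(|U ∩ U'|)` in the binomial basis by the Gregory–Newton formula (Mathlib
  `shift_eq_sum_fwdDiff_iter`) — EVERY element of the Bose–Mesner algebra of `J(n, t)` acts on
  `up^[t−j] p` by the scalar `kernelEigen n t j k = Σ_a (Δ^a k)(0) · binomEigen n t j a`
  (`kernel_ladder`: MS Theorem 10, with the eigenvalue written in the binomial basis instead of the
  Eberlein closed form (44));
* §4 the first relation (the Johnson graph): eigenvalue `t(n−t) − j(n+1−j)` on `V_j`
  (`johnsonGraph_ladder` = MS Theorem 11 (iv), `E_1`);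
* §5 the quadratic form of a kernel on a ladder decomposition is diagonal
  (`sum_kernel_ladder`, `sum_kernel_ladder_ladder_of_ne`, `sum_kernel_ladder_ladder_same`,
  `sum_kernel_ladderDecomposition`, with the tree's `ip_iterate_up_cross` / `ip_iterate_up_of_isHarmonic`);
* §6 Gram kernels `A Aᵀ ∈` Bose–Mesner: `‖Aᵀ f‖²` layer by layer (`sum_sq_gram_ladder`,
  `sum_sq_gram_ladderDecomposition`) — the second-singular-value entry point for bi-relation kernels
  on (`t`-sets) × (anything), e.g. (odd `t`-sets) × (perfect matchings);
* §7 spectral BOUNDS: Parseval on `t`-sets for a ladder decomposition (`sum_sq_ladderSum`), the mass of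
  the constant layer `V_0` is the squared mean (`ladder_zero_mass_eq`), Rayleigh bounds for kernels and
  Gram kernels on and off the constants (`sum_kernel_ladderSum_le`, `sum_kernel_le_of_sum_eq_zero`,
  `sum_sq_gram_le_of_sum_eq_zero`: `‖Aᵀ f‖² ≤ Λ ‖f‖²` for `f ⟂ 𝟙` when the eigenvalues on
  `V_1, …, V_t` are `≤ Λ`), and the ZERO-RECTANGLE MIXING BOUND
  `card_mul_card_mul_sq_le_of_sum_eq_zero`: if `A` has constant column sums `d_C` and vanishes (in sum)
  on `X × Y`, then `|X|·|Y|·d_C² ≤ Λ · C(n,t) · (C(n,t) − |X|)`, i.e. `μ(X) ν(Y) ≤ (1 − μ(X)) Λ/λ₀` —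
  the flag-free case of Haemers' inequality for incidence structures [BrouwerHaemers2012, Thm. 4.9.1]
  by the Cauchy–Schwarz proof of the expander mixing lemma [BrouwerHaemers2012, Prop. 4.3.2]; for
  ROW- and column-regular `A` the two-sided printed form `μ ν ≤ (1 − μ)(1 − ν) Λ/λ₀`
  (`card_mul_card_mul_sq_le_of_sum_eq_zero_of_biregular`, §7 continued at the end of the file), with
  `λ₀ = kernelEigen n t 0 κ = Σ_{U'} κ(|U ∩ U'|) = d_R d_C` (`sum_kernel_eq_kernelEigen_zero`,
  `kernelEigen_zero_eq_rowSum_mul_colSum`) and Haemers' inequality in its printed shape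
  `|X|·|Y|·d_R d_C ≤ θ₂² (C(n,t) − |X|)(|β| − |Y|)` (`card_mul_card_mul_rowSum_mul_colSum_le`);
* §8 DEGREE TRUNCATION on the slice: layers `V_j`, `j ≥ 1`, have zero mean
  (`sum_powersetCard_ladder_eq_zero`); a ladder sum is the cube evaluation `zeta` of the coefficient
  vector `Σ_j (t−j)!·p_j` (`ladderSum_apply_eq_zeta`), supported on sets of size `≤ K` when the layers
  `j > K` vanish (`ladderCoeff_eq_zero_of_lt_card`, `lowPart_apply_eq_zeta`), and CONVERSELY every
  polynomial of `x`-degree `≤ K` restricted to a slice lies in `V_0 ⊕ … ⊕ V_K`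
  (`exists_ladderSum_eq_zeta_of_degree_le`, from the tree's `exists_harmonic_decomposition`); the high
  part `f_{>K}` has zero mean and no larger norm (`highPart_sum_eq_zero_and_sum_sq_le`) and its image
  under a Gram class-function kernel is bounded by the eigenvalues beyond `K` times the FULL norm
  (`sum_sq_gram_highPart_le`) — the Johnson-side bookkeeping of degree-truncation (low part exact by a
  design / high part by the deep spectrum) arguments;
* §9 DIPOLE PRODUCTS: the Frankl–Graham / Filmus functions `χ_{a,b} = Π_{i<k} (x_{a_i} − x_{b_i})`
  [Filmus2016, Def. 2.2] as explicit coefficient vectors `dipoleVec k a b` (recursion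
  `χ = x_{a₀}χ' − x_{b₀}χ'` via the multiplication operator `mulVar`), with the Leibniz rule
  `W (x_c v) = x_c (W v) + v` (`down_mulVar`), HARMONICITY `isHarmonic_dipoleVec` [Filmus2016, Lemma 2.3]
  for injective disjoint `a, b`, the cube evaluation `zeta χ_{a,b} (U) = Π_i (𝟙[a_i ∈ U] − 𝟙[b_i ∈ U])`
  (`zeta_dipoleVec`), the norm `⟪χ, χ⟫ = 2^k` (`ip_dipoleVec_self`), nonvanishing of the test vector
  `(Wᵀ)^{t−k} χ` on every slice `k ≤ t ≤ n/2` (`sum_sq_ladder_dipoleVec(_pos)`) and the eigenvalue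
  identity `⟨φ, K φ⟩ = kernelEigen n t k κ · Πλ · 2^k` (`sum_kernel_dipoleVec`) — every layer `V_k`
  is nonzero and its eigenvalue under any Bose–Mesner kernel is the Rayleigh quotient of ONE explicit
  vector (the first explicit elements of `Ker W_k` in the tree); hence `kernelEigen n t j κ ≤ Λ` iff ONE
  quadratic form (`kernelEigen_le_iff_dipole`) resp. ONE squared norm `‖Aᵀφ‖²`
  (`kernelEigen_le_iff_dipole_gram`) is `≤ Λ·Πλ·2^j`, with canonical dipoles available for every
  `j ≤ n/2` (`canonicalDipole_spec`); COEFFICIENTS of `χ_{a,b}`: zero on sets through a point outside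
  the dipoles (`dipoleVec_apply_eq_zero_of_mem`) or through a full dipole
  (`dipoleVec_apply_eq_zero_of_pair_mem`), `(−1)^{#b-choices}` on transversals
  (`dipoleVec_apply_transversal`), and a `k`-subset of the dipole points without a full dipole IS a
  transversal (`eq_image_sel_of_subset_of_card`) — so on `k`-sets `χ_{a,b} ∈ {0, ±1}` explicitly.

DEVIATION FROM PRINT (declared): the book proves Theorem 10 through Delsarte's theory of
P- and Q-polynomial schemes; here the eigenvalue property is derived from the commutation relation
`W Wᵀ − Wᵀ W = (n − 2|T|)·id` alone (ladder calculus), and the eigenvalues come out in the binomial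
basis `{C(x, a)}_a` (a finite sum of ladder products) rather than as Eberlein's alternating sum (44);
the two agree as numbers (both are THE eigenvalue) but that identity of closed forms is not needed and
not formalised. Consumer: cell pnp-psdrank (summit PneNP), second-eigenvalue bounds for kernels on
(odd `t`-sets) × (perfect matchings) whose Gram matrix lies in the Bose–Mesner algebra of `J(n, t)`.
No facts, no new instances/notation, standard axioms.

## References
* [MacWilliamsSloane1977] F. J. MacWilliams, N. J. A. Sloane, *The Theory of Error-Correcting Codes*,
  North-Holland 1977, Ch. 21 §6 (Theorems 10, 11; Problem (11)).
* [Delsarte1973] P. Delsarte, *An algebraic approach to the association schemes of coding theory*,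
  Philips Res. Rep. Suppl. 10 (1973), §4.2 (the Johnson scheme).
* [LeePrakashDewolfYuen2016] T. Lee, A. Prakash, R. de Wolf, H. Yuen, CCC 2016, App. B (the ladder
  calculus followed by `JohnsonHarmonics`).
* [BrouwerHaemers2012] A. E. Brouwer, W. H. Haemers, *Spectra of Graphs*, Universitext, Springer 2012
  (held text `book:brouwer2012-spectra-graphs`): Prop. 4.3.2 (expander mixing lemma, PDF p. 83),
  Thm. 4.9.1 (Haemers' inequality for substructures of 1-designs, PDF p. 93) — §7.
* [Filmus2016] Y. Filmus, *An orthogonal basis for functions over a slice of the Boolean hypercube*,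
  Electron. J. Combin. 23(1) (2016) P1.23 (held text `paper:arxiv-1406.0142`): Def. 2.2 (χ_{A,B}),
  Lemma 2.3 (Frankl–Graham basis; harmonicity of χ_{A,B}) — §9.
-/

noncomputable section

open Finset
open scoped BigOperators fwdDiff

namespace Literature.Combinatorics.AssociationSchemes

namespace JohnsonSpectrum

open JohnsonHarmonics

variable {n : ℕ}

/-! ### §1 Iterated lowering of a ladder -/

/-- `W^k` as a power of the linear map `down`.
[cite: LeePrakashDewolfYuen2016, App. B §B.1 (operators W_t; arXiv text chunk 19)] -/
theorem iterate_down_eq_pow (k : ℕ) (v : Finset (Fin n) → ℝ) : down^[k] v = (down ^ k) v := by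
  rw [Module.End.pow_apply]

/-- `W^k` commutes with scalars.
[cite: LeePrakashDewolfYuen2016, App. B §B.1 (operators W_t; arXiv text chunk 19)] -/
theorem iterate_down_smul (k : ℕ) (c : ℝ) (v : Finset (Fin n) → ℝ) :
    down^[k] (c • v) = c • down^[k] v := by
  simp only [iterate_down_eq_pow, map_smul]

/-- `W^k 0 = 0`. [cite: LeePrakashDewolfYuen2016, App. B §B.1 (operators W_t; arXiv text chunk 19)] -/
theorem iterate_down_zero_vec (k : ℕ) : down^[k] (0 : Finset (Fin n) → ℝ) = 0 := by
  rw [iterate_down_eq_pow, map_zero]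

/-- Iterated lowering maps `L_{t+s}` to `L_t`.
[cite: LeePrakashDewolfYuen2016, App. B §B.1 (operators W_t; arXiv text chunk 19)] -/
theorem isHomog_iterate_down {t s : ℕ} {v : Finset (Fin n) → ℝ} (hv : IsHomog (t + s) v) :
    IsHomog t (down^[s] v) := by
  induction s generalizing v with
  | zero => simpa using hv
  | succ s ih =>
    rw [Function.iterate_succ_apply]
    exact ih (isHomog_down (by simpa [add_assoc] using hv))

/-- Iterated adjointness: `⟪(Wᵀ)^s a, b⟫ = ⟪a, W^s b⟫`.
[cite: LeePrakashDewolfYuen2016, App. B §B.3 (adjointness of W_t and W_tᵀ; arXiv text chunk 20)] -/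
theorem ip_iterate_up_left (a b : Finset (Fin n) → ℝ) (s : ℕ) :
    ip (up^[s] a) b = ip a (down^[s] b) := by
  induction s generalizing b with
  | zero => rfl
  | succ s ih => rw [Function.iterate_succ_apply', ip_up_left, ih, ← Function.iterate_succ_apply]

/-- The product of ladder eigenvalues met when lowering `s` times from rung `m`:
`Π_{r<s} λ_j(m−1−r)` with `λ_j(i) = (i+1)(n−2j−i)` (`JohnsonHarmonics.ladder`).
[cite: MacWilliamsSloane1977, Ch. 21 §6 Thm. 10 (eigenvalues of the Johnson scheme; PDF p. 516)] -/
def ladderProd (n j m s : ℕ) : ℝ := ∏ r ∈ range s, ladder n j (m - 1 - r)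

/-- Unfolding of `ladderProd`. [cite: MacWilliamsSloane1977, Ch. 21 §6 Thm. 10 (PDF p. 516)] -/
theorem ladderProd_zero (n j m : ℕ) : ladderProd n j m 0 = 1 := by simp [ladderProd]

/-- One more lowering step: `Π_{r<s+1} λ_j(m−1−r) = λ_j(m−1) · Π_{r<s} λ_j(m−2−r)`.
[cite: MacWilliamsSloane1977, Ch. 21 §6 Thm. 10 (PDF p. 516)] -/
theorem ladderProd_succ (n j m s : ℕ) :
    ladderProd n j (m + 1) (s + 1) = ladder n j m * ladderProd n j m s := by
  unfold ladderProd
  rw [prod_range_succ', mul_comm]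
  congr 1
  refine prod_congr rfl fun r _ => ?_
  congr 1
  omega

/-- **Iterated lowering of a ladder**: for `p` harmonic of degree `j` and `s ≤ m`,
`W^s (Wᵀ)^m p = (Π_{r<s} λ_j(m−1−r)) · (Wᵀ)^{m−s} p`.
[cite: MacWilliamsSloane1977, Ch. 21 §6 Thm. 10 (eigenvalues of the Johnson scheme; PDF p. 516)] -/
theorem iterate_down_iterate_up_of_isHarmonic {j : ℕ} {p : Finset (Fin n) → ℝ} (hp : IsHarmonic j p)
    {s m : ℕ} (hsm : s ≤ m) :
    down^[s] (up^[m] p) = ladderProd n j m s • up^[m - s] p := by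
  induction s generalizing m with
  | zero => simp [ladderProd_zero]
  | succ s ih =>
    obtain ⟨m, rfl⟩ : ∃ m', m = m' + 1 := ⟨m - 1, by omega⟩
    rw [Function.iterate_succ_apply, down_iterate_up_of_isHarmonic hp m, iterate_down_smul,
      ih (by omega), smul_smul, ladderProd_succ]
    congr 2
    omega

/-- Lowering a ladder below its base kills it: for `p` harmonic of degree `j` and `m < s`,
`W^s (Wᵀ)^m p = 0`.
[cite: MacWilliamsSloane1977, Ch. 21 §6 Thm. 10 (eigenvalues of the Johnson scheme; PDF p. 516)] -/
theorem iterate_down_iterate_up_of_lt {j : ℕ} {p : Finset (Fin n) → ℝ} (hp : IsHarmonic j p)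
    {s m : ℕ} (hms : m < s) : down^[s] (up^[m] p) = 0 := by
  obtain ⟨d, rfl⟩ := Nat.exists_eq_add_of_lt hms
  rw [show m + d + 1 = (d + 1) + m by ring, Function.iterate_add_apply,
    iterate_down_iterate_up_of_isHarmonic hp le_rfl, Nat.sub_self, Function.iterate_zero, id_eq,
    iterate_down_smul, show d + 1 = d + 1 from rfl, Function.iterate_succ_apply, hp.2,
    iterate_down_zero_vec, smul_zero]

/-- **`(Wᵀ)^s W^s` is a scalar on every ladder**: for `p` harmonic of degree `j` and `s ≤ m`,
`(Wᵀ)^s W^s (Wᵀ)^m p = (Π_{r<s} λ_j(m−1−r)) · (Wᵀ)^m p`.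
[cite: MacWilliamsSloane1977, Ch. 21 §6 Thm. 10 (eigenvalues of the Johnson scheme; PDF p. 516)] -/
theorem iterate_up_down_ladder {j : ℕ} {p : Finset (Fin n) → ℝ} (hp : IsHarmonic j p)
    {s m : ℕ} (hsm : s ≤ m) :
    up^[s] (down^[s] (up^[m] p)) = ladderProd n j m s • up^[m] p := by
  rw [iterate_down_iterate_up_of_isHarmonic hp hsm, iterate_up_smul, ← Function.iterate_add_apply,
    Nat.add_sub_cancel' hsm]

/-- … and `(Wᵀ)^s W^s (Wᵀ)^m p = 0` for `m < s`.
[cite: MacWilliamsSloane1977, Ch. 21 §6 Thm. 10 (eigenvalues of the Johnson scheme; PDF p. 516)] -/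
theorem iterate_up_down_ladder_of_lt {j : ℕ} {p : Finset (Fin n) → ℝ} (hp : IsHarmonic j p)
    {s m : ℕ} (hms : m < s) : up^[s] (down^[s] (up^[m] p)) = 0 := by
  rw [iterate_down_iterate_up_of_lt hp hms, iterate_up_zero_vec]


/-! ### §2 The kernel of `(Wᵀ)^s W^s` on `L_t`: binomial coefficients of intersections -/

/-- The indicator (coordinate) vector of a subset `V`.
[cite: MacWilliamsSloane1977, Ch. 21 §6 Problem (11) (inclusion matrices A_i; PDF p. 516)] -/
def delta (V : Finset (Fin n)) : Finset (Fin n) → ℝ := fun S => if S = V then 1 else 0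

/-- Unfolding of `delta`. [cite: MacWilliamsSloane1977, Ch. 21 §6 Problem (11) (PDF p. 516)] -/
@[simp] theorem delta_apply (V S : Finset (Fin n)) : delta V S = if S = V then 1 else 0 := rfl

/-- `δ_V` is homogeneous of degree `|V|`.
[cite: MacWilliamsSloane1977, Ch. 21 §6 Problem (11) (PDF p. 516)] -/
theorem isHomog_delta (V : Finset (Fin n)) : IsHomog V.card (delta V) := by
  intro S hS
  rw [delta_apply, if_neg]
  rintro rfl
  exact hS rfl

/-- `⟪u, δ_V⟫ = u V`. [cite: MacWilliamsSloane1977, Ch. 21 §6 Problem (11) (PDF p. 516)] -/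
theorem ip_delta_right (u : Finset (Fin n) → ℝ) (V : Finset (Fin n)) : ip u (delta V) = u V := by
  simp [ip]

/-- On the cube `δ_V` is the monomial `x^V`: `zeta δ_V (U) = [V ⊆ U]`.
[cite: MacWilliamsSloane1977, Ch. 21 §6 Problem (11) ((A_i)_{x,ξ} = [ξ ⊂ x]; PDF p. 516)] -/
theorem zeta_delta (V U : Finset (Fin n)) : zeta (delta V) U = if V ⊆ U then 1 else 0 := by
  rw [zeta_apply]
  simp only [delta_apply, sum_ite_eq', mem_powerset]

/-- **Iterated lowering, explicitly**: for `v ∈ L_{r+s}` and `|V| = r`,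
`(W^s v) V = s! · Σ_{U ⊇ V, |U| = r+s} v(U)` (dual to `iterate_up_apply_of_isHomog`).
[cite: MacWilliamsSloane1977, Ch. 21 §6 Problem (11) (A_i A_iᵀ; PDF p. 516)] -/
theorem iterate_down_apply_of_isHomog {r s : ℕ} {v : Finset (Fin n) → ℝ} (hv : IsHomog (r + s) v)
    {V : Finset (Fin n)} (hV : V.card = r) :
    (down^[s] v) V = (s.factorial : ℝ) *
      ∑ U ∈ univ.filter (fun U : Finset (Fin n) => V ⊆ U ∧ U.card = r + s), v U := by
  rw [← ip_delta_right (down^[s] v) V, ip_comm, ← ip_iterate_up_left, ip, sum_filter, mul_sum]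
  refine sum_congr rfl fun U _ => ?_
  by_cases hU : U.card = r + s
  · rw [iterate_up_apply_of_isHomog (isHomog_delta V) (by rw [hV, hU]), zeta_delta]
    by_cases hVU : V ⊆ U
    · rw [if_pos hVU, if_pos ⟨hVU, hU⟩, mul_one]
    · rw [if_neg hVU, if_neg (fun h => hVU h.1), mul_zero, zero_mul]
  · rw [hv U hU, mul_zero, if_neg (fun h => hU h.2), mul_zero]

/-- **The kernel of `(Wᵀ)^s W^s` on `L_t`** (`s ≤ t`): for `v ∈ L_t` and `|U| = t`,
`((Wᵀ)^s W^s v) U = (s!)² Σ_{|U'| = t} C(|U ∩ U'|, t − s) v(U')` — MacWilliams–Sloane's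
`C_{t−s} = A_{t−s} A_{t−s}ᵀ` has entries `C(|U ∩ U'|, t − s)`.
[cite: MacWilliamsSloane1977, Ch. 21 §6 Problem (11) (C_i = A_i A_iᵀ = Σ_k C(k,i) D_{n−k}; PDF p. 516)] -/
theorem iterate_up_iterate_down_apply {t s : ℕ} (hst : s ≤ t) {v : Finset (Fin n) → ℝ}
    (hv : IsHomog t v) {U : Finset (Fin n)} (hU : U.card = t) :
    (up^[s] (down^[s] v)) U = (s.factorial : ℝ) ^ 2 *
      ∑ U' ∈ univ.powersetCard t, (((U ∩ U').card.choose (t - s) : ℕ) : ℝ) * v U' := by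
  have hv' : IsHomog (t - s + s) v := by rwa [Nat.sub_add_cancel hst]
  have hw : IsHomog (t - s) (down^[s] v) := isHomog_iterate_down hv'
  rw [iterate_up_apply_of_isHomog hw (by rw [hU, Nat.sub_add_cancel hst]), zeta_apply]
  -- only the `(t − s)`-subsets of `U` contribute
  have hzero : ∑ V ∈ U.powerset, (down^[s] v) V =
      ∑ V ∈ U.powerset.filter (fun V => V.card = t - s), (down^[s] v) V :=
    (sum_filter_of_ne fun V _ h => by by_contra hc; exact h (hw V hc)).symm
  rw [hzero]
  -- expand each `(W^s v) V` and exchange the two summations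
  have hexp : ∀ V ∈ U.powerset.filter (fun V => V.card = t - s),
      (down^[s] v) V = (s.factorial : ℝ) *
        ∑ U' ∈ univ.powersetCard t, (if V ⊆ U' then v U' else 0) := by
    intro V hV
    rw [iterate_down_apply_of_isHomog hv' (mem_filter.1 hV).2, Nat.sub_add_cancel hst, sum_filter]
    congr 1
    rw [← sum_filter, ← sum_filter]
    refine sum_congr ?_ fun _ _ => rfl
    ext U'
    simp only [mem_filter, mem_univ, true_and, mem_powersetCard_univ, and_comm]
  have hinner : ∀ U' : Finset (Fin n),
      ∑ V ∈ U.powerset.filter (fun V => V.card = t - s), (if V ⊆ U' then v U' else 0) =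
        (((U ∩ U').card.choose (t - s) : ℕ) : ℝ) * v U' := by
    intro U'
    rw [← sum_filter, sum_const, nsmul_eq_mul]
    congr 2
    rw [← card_powersetCard (t - s) (U ∩ U')]
    congr 1
    ext V
    simp only [mem_filter, mem_powerset, mem_powersetCard, subset_inter_iff]
    tauto
  have hswap : ∑ V ∈ U.powerset.filter (fun V => V.card = t - s),
      (s.factorial : ℝ) * ∑ U' ∈ univ.powersetCard t, (if V ⊆ U' then v U' else 0) =
      (s.factorial : ℝ) * ∑ U' ∈ univ.powersetCard t,
        (((U ∩ U').card.choose (t - s) : ℕ) : ℝ) * v U' := by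
    rw [← mul_sum, sum_comm]
    simp_rw [hinner]
  rw [sum_congr rfl hexp, hswap]
  ring


/-! ### §3 Every kernel `k(|U ∩ U'|)` is a scalar on each ladder (MS Theorem 10) -/

/-- The eigenvalue of the binomial kernel `C(|U ∩ U'|, a)` on the ladder `(Wᵀ)^{t−j} Ker W_j`
(the book's eigenspace `V_j`): `[j ≤ a] · Π_{r < t−a} λ_j(t−j−1−r) / ((t−a)!)²`.
[cite: MacWilliamsSloane1977, Ch. 21 §6 Thm. 10 with Problem (11) (eigenvalues of C_i = A_i A_iᵀ; PDF p. 516)] -/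
def binomEigen (n t j a : ℕ) : ℝ :=
  if j ≤ a then ladderProd n j (t - j) (t - a) / ((t - a).factorial : ℝ) ^ 2 else 0

/-- **Binomial kernels are scalars on ladders**: for `p` harmonic of degree `j ≤ t`, `a ≤ t` and
`|U| = t`, `Σ_{|U'| = t} C(|U ∩ U'|, a) · ((Wᵀ)^{t−j} p)(U') = binomEigen n t j a · ((Wᵀ)^{t−j} p)(U)`.
[cite: MacWilliamsSloane1977, Ch. 21 §6 Thm. 10 with Problem (11) (PDF p. 516)] -/
theorem binomKernel_ladder {t j a : ℕ} (hjt : j ≤ t) (hat : a ≤ t) {p : Finset (Fin n) → ℝ}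
    (hp : IsHarmonic j p) {U : Finset (Fin n)} (hU : U.card = t) :
    ∑ U' ∈ univ.powersetCard t, (((U ∩ U').card.choose a : ℕ) : ℝ) * (up^[t - j] p) U' =
      binomEigen n t j a * (up^[t - j] p) U := by
  have hv : IsHomog t (up^[t - j] p) := by
    have := isHomog_iterate_up hp.1 (t - j); rwa [Nat.add_sub_cancel' hjt] at this
  have hfac : ((t - a).factorial : ℝ) ^ 2 ≠ 0 := pow_ne_zero _ (Nat.cast_ne_zero.2 (Nat.factorial_ne_zero _))
  have key := iterate_up_iterate_down_apply (s := t - a) (Nat.sub_le t a) hv hU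
  rw [Nat.sub_sub_self hat] at key
  -- `key : ((Wᵀ)^{t−a} W^{t−a} v) U = ((t−a)!)² · Σ C(|U∩U'|, a) v U'`
  have hsum : ∑ U' ∈ univ.powersetCard t, (((U ∩ U').card.choose a : ℕ) : ℝ) * (up^[t - j] p) U' =
      (up^[t - a] (down^[t - a] (up^[t - j] p))) U / ((t - a).factorial : ℝ) ^ 2 := by
    rw [key, mul_div_cancel_left₀ _ hfac]
  rw [hsum]
  unfold binomEigen
  by_cases hja : j ≤ a
  · rw [if_pos hja, iterate_up_down_ladder hp (by omega), Pi.smul_apply, smul_eq_mul]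
    ring
  · rw [if_neg hja, iterate_up_down_ladder_of_lt hp (by omega), Pi.zero_apply, zero_div, zero_mul]

/-- Gregory–Newton expansion of a kernel profile in the binomial basis, truncated at `t`:
for `x ≤ t`, `k(x) = Σ_{a ≤ t} C(x, a) · (Δ^a k)(0)`.
[cite: MacWilliamsSloane1977, Ch. 21 §6 Problem (11) ("Hence C_0, …, C_n is a basis for 𝒜"; PDF p. 516)] -/
theorem newton_choose_expansion (k : ℕ → ℝ) {t x : ℕ} (hx : x ≤ t) :
    k x = ∑ a ∈ range (t + 1), ((x.choose a : ℕ) : ℝ) * ((fwdDiff (1 : ℕ))^[a] k 0) := by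
  have h := shift_eq_sum_fwdDiff_iter (1 : ℕ) k x 0
  rw [zero_add, smul_eq_mul, mul_one] at h
  rw [h, ← sum_range_add_sum_Ico _ (Nat.succ_le_succ hx)]
  rw [sum_eq_zero (s := Ico (x + 1) (t + 1)) fun a ha => by
    rw [Nat.choose_eq_zero_of_lt (by have := (mem_Ico.1 ha).1; omega), Nat.cast_zero, zero_mul]]
  rw [add_zero]
  refine sum_congr rfl fun a _ => ?_
  rw [nsmul_eq_mul]

/-- The eigenvalue of the kernel `k(|U ∩ U'|)` on the ladder `(Wᵀ)^{t−j} Ker W_j`, in the binomial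
basis: `Σ_{a ≤ t} (Δ^a k)(0) · binomEigen n t j a` (as a number, the Eberlein value `Σ_i k(t−i) E_i(j)`).
[cite: MacWilliamsSloane1977, Ch. 21 §6 Thm. 10 (p_k(i) = E_k(i); PDF p. 516)] -/
def kernelEigen (n t j : ℕ) (k : ℕ → ℝ) : ℝ :=
  ∑ a ∈ range (t + 1), ((fwdDiff (1 : ℕ))^[a] k 0) * binomEigen n t j a

/-- **Spectral theorem of the Johnson scheme (ladder form)**: every kernel depending only on
`|U ∩ U'|` — i.e. every element of the Bose–Mesner algebra of `J(n, t)` — acts on the ladder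
`(Wᵀ)^{t−j} p`, `p` harmonic of degree `j ≤ t`, as the scalar `kernelEigen n t j k`:
`Σ_{|U'| = t} k(|U ∩ U'|) ((Wᵀ)^{t−j} p)(U') = kernelEigen n t j k · ((Wᵀ)^{t−j} p)(U)` for `|U| = t`.
[cite: MacWilliamsSloane1977, Ch. 21 §6 Thm. 10 (eigenvalues of the Johnson scheme; PDF p. 516)] -/
theorem kernel_ladder {t j : ℕ} (hjt : j ≤ t) {p : Finset (Fin n) → ℝ} (hp : IsHarmonic j p)
    (k : ℕ → ℝ) {U : Finset (Fin n)} (hU : U.card = t) :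
    ∑ U' ∈ univ.powersetCard t, k (U ∩ U').card * (up^[t - j] p) U' =
      kernelEigen n t j k * (up^[t - j] p) U := by
  have hexp : ∀ U' ∈ univ.powersetCard t, k (U ∩ U').card * (up^[t - j] p) U' =
      ∑ a ∈ range (t + 1), ((fwdDiff (1 : ℕ))^[a] k 0) *
        ((((U ∩ U').card.choose a : ℕ) : ℝ) * (up^[t - j] p) U') := by
    intro U' _
    rw [newton_choose_expansion k (show (U ∩ U').card ≤ t from
      (card_le_card inter_subset_left).trans hU.le), sum_mul]
    refine sum_congr rfl fun a _ => ?_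
    ring
  rw [sum_congr rfl hexp, sum_comm]
  unfold kernelEigen
  rw [sum_mul]
  refine sum_congr rfl fun a ha => ?_
  rw [← mul_sum, binomKernel_ladder hjt (by have := mem_range.1 ha; omega) hp hU, mul_assoc]


/-! ### §4 The first relation: the Johnson graph `J(n, t)` (MS Theorem 11 (iv), `E_1`) -/

/-- The binomial eigenvalue at `a = t − 1` is the first ladder eigenvalue:
`binomEigen n t j (t−1) = (t − j)(n − t − j + 1)` (`1 ≤ t`, `j ≤ t`).
[cite: MacWilliamsSloane1977, Ch. 21 §6 Thm. 11 (iv) (E_1(x) = n(l−n) − x(l+1−x); PDF p. 516)] -/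
theorem binomEigen_sub_one {t j : ℕ} (ht : 1 ≤ t) (hjt : j ≤ t) :
    binomEigen n t j (t - 1) = ((t : ℝ) - j) * ((n : ℝ) - t - j + 1) := by
  unfold binomEigen
  by_cases hj : j ≤ t - 1
  · rw [if_pos hj, show t - (t - 1) = 1 by omega, Nat.factorial_one, Nat.cast_one, one_pow, div_one,
      show (1 : ℕ) = 0 + 1 from rfl, show t - j = (t - j - 1) + 1 by omega, ladderProd_succ,
      ladderProd_zero, mul_one, ladder, Nat.cast_sub (by omega : 1 ≤ t - j), Nat.cast_sub hjt,
      Nat.cast_one]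
    ring
  · have hj' : j = t := by omega
    subst hj'
    rw [if_neg hj, sub_self, zero_mul]

/-- **The Johnson graph on `t`-sets is diagonal on ladders with eigenvalue `t(n−t) − j(n+1−j)`**
(= `(t−j)(n−t−j+1) − t`, MacWilliams–Sloane's `E_1(j)`): for `p` harmonic of degree `j ≤ t` and
`|U| = t`, `Σ_{|U'| = t, |U ∩ U'| = t−1} ((Wᵀ)^{t−j} p)(U') = (t(n−t) − j(n+1−j)) · ((Wᵀ)^{t−j} p)(U)`.
[cite: MacWilliamsSloane1977, Ch. 21 §6 Thm. 11 (iv) (E_1(x) = n(l−n) − x(l+1−x); PDF p. 516)] -/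
theorem johnsonGraph_ladder {t j : ℕ} (hjt : j ≤ t) {p : Finset (Fin n) → ℝ} (hp : IsHarmonic j p)
    {U : Finset (Fin n)} (hU : U.card = t) :
    ∑ U' ∈ (univ.powersetCard t).filter (fun U' => (U ∩ U').card + 1 = t), (up^[t - j] p) U' =
      ((t : ℝ) * ((n : ℝ) - t) - j * ((n : ℝ) + 1 - j)) * (up^[t - j] p) U := by
  rcases Nat.eq_zero_or_pos t with rfl | ht
  · have hj : j = 0 := by omega
    subst hj
    simp
  -- split the binomial kernel `C(|U ∩ U'|, t−1)` into the adjacency part and the diagonal part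
  have hsplit : ∀ U' ∈ univ.powersetCard t,
      ((((U ∩ U').card.choose (t - 1) : ℕ) : ℝ)) * (up^[t - j] p) U' =
        (if (U ∩ U').card + 1 = t then (up^[t - j] p) U' else 0) +
          (if U' = U then (t : ℝ) * (up^[t - j] p) U' else 0) := by
    intro U' hU'
    rw [mem_powersetCard_univ] at hU'
    by_cases hUU : U' = U
    · subst hUU
      rw [inter_self, hU, if_neg (by omega), if_pos rfl, zero_add, Nat.choose_symm ht,
        Nat.choose_one_right]
    · have hlt : (U ∩ U').card < t := by
        refine lt_of_le_of_ne ((card_le_card inter_subset_left).trans hU.le) fun h => hUU ?_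
        have h1 : U ∩ U' = U := eq_of_subset_of_card_le inter_subset_left (by rw [h, hU])
        exact (eq_of_subset_of_card_le (inter_eq_left.1 h1) (by rw [hU, hU'])).symm
      rw [if_neg hUU, add_zero]
      by_cases hadj : (U ∩ U').card + 1 = t
      · rw [if_pos hadj, show t - 1 = (U ∩ U').card by omega, Nat.choose_self, Nat.cast_one, one_mul]
      · rw [if_neg hadj, Nat.choose_eq_zero_of_lt (by omega), Nat.cast_zero, zero_mul]
  have key := binomKernel_ladder hjt (Nat.sub_le t 1) hp hU
  rw [sum_congr rfl hsplit, sum_add_distrib, ← sum_filter, sum_ite_eq' (univ.powersetCard t) U,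
    if_pos (mem_powersetCard_univ.2 hU), binomEigen_sub_one ht hjt] at key
  -- `key : Σ_adj + t · v U = (t−j)(n−t−j+1) · v U`
  have := key
  linear_combination this

/-! ### §5 Quadratic forms: a kernel is diagonal on a ladder decomposition -/

/-- For `v ∈ L_t` the coefficient inner product only sees the `t`-sets:
`Σ_{|U| = t} f(U) v(U) = ⟪f, v⟫`.
[cite: LeePrakashDewolfYuen2016, App. B §B.3 (inner product ⟨p|q⟩ := Σ_S p_S q_S; arXiv text chunk 20)] -/
theorem sum_powersetCard_mul_of_isHomog {t : ℕ} (f : Finset (Fin n) → ℝ) {v : Finset (Fin n) → ℝ}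
    (hv : IsHomog t v) : ∑ U ∈ univ.powersetCard t, f U * v U = ip f v := by
  rw [ip, ← sum_filter_of_ne (s := (univ : Finset (Finset (Fin n))))
    (p := fun U : Finset (Fin n) => U.card = t) (fun U _ h => by
      by_contra hc; exact h (by rw [hv U hc, mul_zero]))]
  congr 1
  ext U
  simp only [mem_powersetCard_univ, mem_filter, mem_univ, true_and]

/-- **A kernel's bilinear form against a ladder is a scalar times the coefficient pairing**: for
`p` harmonic of degree `j ≤ t`, any `f` and any profile `k`,
`Σ_{|U| = |U'| = t} f(U) · k(|U ∩ U'|) · ((Wᵀ)^{t−j} p)(U') = kernelEigen n t j k · ⟪f, (Wᵀ)^{t−j} p⟫`;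
with `JohnsonHarmonics.ip_iterate_up_cross` (different degrees are orthogonal) and
`ip_iterate_up_of_isHarmonic` (ladder norms) the form is diagonal on a ladder decomposition
(next two statements).
[cite: MacWilliamsSloane1977, Ch. 21 §6 Thm. 10 (common eigenspaces of the Bose–Mesner algebra; PDF p. 516)] -/
theorem sum_kernel_ladder {t j : ℕ} (hjt : j ≤ t) {p : Finset (Fin n) → ℝ} (hp : IsHarmonic j p)
    (f : Finset (Fin n) → ℝ) (k : ℕ → ℝ) :
    ∑ U ∈ univ.powersetCard t, ∑ U' ∈ univ.powersetCard t,
        f U * (k (U ∩ U').card * (up^[t - j] p) U') =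
      kernelEigen n t j k * ip f (up^[t - j] p) := by
  have hv : IsHomog t (up^[t - j] p) := by
    have := isHomog_iterate_up hp.1 (t - j); rwa [Nat.add_sub_cancel' hjt] at this
  have hinner : ∀ U ∈ univ.powersetCard t,
      ∑ U' ∈ univ.powersetCard t, f U * (k (U ∩ U').card * (up^[t - j] p) U') =
        f U * (kernelEigen n t j k * (up^[t - j] p) U) := by
    intro U hU
    rw [← mul_sum, kernel_ladder hjt hp k (mem_powersetCard_univ.1 hU)]
  rw [sum_congr rfl hinner, ← sum_powersetCard_mul_of_isHomog f hv, mul_sum]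
  refine sum_congr rfl fun U _ => ?_
  ring

/-- **Different degrees do not interact**: for `j ≠ j'` the paired form of the previous theorem
vanishes (the ladders `(Wᵀ)^{t−j} Ker W_j` and `(Wᵀ)^{t−j'} Ker W_{j'}` are orthogonal and each is
an eigenspace of the kernel).
[cite: MacWilliamsSloane1977, Ch. 21 §6 Thm. 10 (common eigenspaces of the Bose–Mesner algebra; PDF p. 516)] -/
theorem sum_kernel_ladder_ladder_of_ne {t j j' : ℕ} (hjt : j ≤ t) (hj't : j' ≤ t) (hne : j ≠ j')
    {p q : Finset (Fin n) → ℝ} (hp : IsHarmonic j p) (hq : IsHarmonic j' q) (k : ℕ → ℝ) :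
    ∑ U ∈ univ.powersetCard t, ∑ U' ∈ univ.powersetCard t,
        (up^[t - j'] q) U * (k (U ∩ U').card * (up^[t - j] p) U') = 0 := by
  rw [sum_kernel_ladder hjt hp _ k]
  rcases lt_or_gt_of_ne hne with h | h
  · -- `j < j'`: the ladder over `p` is longer by `j' − j ≥ 1`
    rw [show t - j = (t - j') + (j' - j) by omega, ip_iterate_up_cross hp hq.2 (by omega), mul_zero]
  · rw [ip_comm, show t - j' = (t - j) + (j - j') by omega, ip_iterate_up_cross hq hp.2 (by omega),
      mul_zero]

/-- **Same rung**: against a ladder `(Wᵀ)^{t−j} q` of the same length (`q` arbitrary, `p` harmonic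
of degree `j`) the paired form is `kernelEigen · (Π_{i<t−j} λ_j(i)) · ⟪q, p⟫` (ladder norms).
[cite: MacWilliamsSloane1977, Ch. 21 §6 Thm. 10 (common eigenspaces of the Bose–Mesner algebra; PDF p. 516)] -/
theorem sum_kernel_ladder_ladder_same {t j : ℕ} (hjt : j ≤ t)
    {p : Finset (Fin n) → ℝ} (hp : IsHarmonic j p) (q : Finset (Fin n) → ℝ) (k : ℕ → ℝ) :
    ∑ U ∈ univ.powersetCard t, ∑ U' ∈ univ.powersetCard t,
        (up^[t - j] q) U * (k (U ∩ U').card * (up^[t - j] p) U') =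
      kernelEigen n t j k * ((∏ i ∈ range (t - j), ladder n j i) * ip q p) := by
  rw [sum_kernel_ladder hjt hp _ k, ip_iterate_up_of_isHarmonic hp]


/-- **The quadratic form of a kernel on a ladder decomposition is diagonal**: for
`f = Σ_{j ≤ t} (Wᵀ)^{t−j} p_j` with `p_j` harmonic of degree `j` (the tree's
`JohnsonHarmonics.exists_ladder_decomposition` provides this for every `f ∈ L_t` when `2t ≤ n+1`),
`Σ_{|U| = |U'| = t} f(U) k(|U ∩ U'|) f(U') = Σ_j kernelEigen n t j k · (Π_{i<t−j} λ_j(i)) · ⟪p_j, p_j⟫` —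
the Rayleigh quotient of the kernel is a convex combination of its ladder eigenvalues.
[cite: MacWilliamsSloane1977, Ch. 21 §6 Thm. 10 (common eigenspaces of the Bose–Mesner algebra; PDF p. 516)] -/
theorem sum_kernel_ladderDecomposition {t : ℕ} (p : ℕ → Finset (Fin n) → ℝ)
    (hp : ∀ j, IsHarmonic j (p j)) (k : ℕ → ℝ) :
    ∑ U ∈ univ.powersetCard t, ∑ U' ∈ univ.powersetCard t,
        (∑ j ∈ range (t + 1), up^[t - j] (p j)) U *
          (k (U ∩ U').card * (∑ j ∈ range (t + 1), up^[t - j] (p j)) U') =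
      ∑ j ∈ range (t + 1),
        kernelEigen n t j k * ((∏ i ∈ range (t - j), ladder n j i) * ip (p j) (p j)) := by
  set f : Finset (Fin n) → ℝ := ∑ j ∈ range (t + 1), up^[t - j] (p j) with hf
  -- distribute over the decomposition of the right-hand factor
  have hdist : ∀ U U' : Finset (Fin n), f U * (k (U ∩ U').card * f U') =
      ∑ j ∈ range (t + 1), f U * (k (U ∩ U').card * (up^[t - j] (p j)) U') := by
    intro U U'
    have hU' : f U' = ∑ j ∈ range (t + 1), (up^[t - j] (p j)) U' := by rw [hf, Finset.sum_apply]
    rw [hU', mul_sum, mul_sum]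
  simp_rw [hdist]
  rw [sum_congr rfl fun U _ => sum_comm, sum_comm]
  refine sum_congr rfl fun j hj => ?_
  have hjt : j ≤ t := by have := mem_range.1 hj; omega
  rw [sum_kernel_ladder hjt (hp j) f k]
  congr 1
  -- `⟪f, (Wᵀ)^{t−j} p_j⟫` only sees the `j`-th ladder
  rw [hf, ip_sum_left, sum_eq_single_of_mem j hj fun j' hj' hne => ?_, ip_iterate_up_of_isHarmonic (hp j)]
  have hj't : j' ≤ t := by have := mem_range.1 hj'; omega
  rcases lt_or_gt_of_ne hne with h | h
  · rw [ip_comm, show t - j' = (t - j) + (j - j') by omega]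
    exact ip_iterate_up_cross (hp j') (hp j).2 (by omega) _
  · rw [show t - j = (t - j') + (j' - j) by omega]
    exact ip_iterate_up_cross (hp j) (hp j').2 (by omega) _


/-! ### §6 Gram kernels in the Bose–Mesner algebra: `‖Aᵀ f‖²` layer by layer (appended) -/

/-- **Gram kernels, one layer**: if a matrix `A` on (`t`-sets) × `β` has Gram kernel
`Σ_b A(U,b) A(U',b) = κ(|U ∩ U'|)` on `t`-sets (i.e. `A Aᵀ` lies in the Bose–Mesner algebra of
`J(n,t)`), then for `p` harmonic of degree `j ≤ t`,
`Σ_b (Σ_{|U|=t} ((Wᵀ)^{t−j} p)(U) A(U,b))² = kernelEigen n t j κ · ⟪(Wᵀ)^{t−j} p, (Wᵀ)^{t−j} p⟫` —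
`Aᵀ` restricted to the layer `V_j` is `√(kernelEigen)` times an isometry.
[cite: MacWilliamsSloane1977, Ch. 21 §6 Thm. 10 with Problem (11) (C_i = A_i A_iᵀ ∈ 𝒜; PDF p. 516)] -/
theorem sum_sq_gram_ladder {β : Type*} [Fintype β] {t j : ℕ} (hjt : j ≤ t)
    (A : Finset (Fin n) → β → ℝ) (κ : ℕ → ℝ)
    (hA : ∀ U ∈ univ.powersetCard t, ∀ U' ∈ univ.powersetCard t,
      ∑ b, A U b * A U' b = κ (U ∩ U').card)
    {p : Finset (Fin n) → ℝ} (hp : IsHarmonic j p) :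
    ∑ b, (∑ U ∈ univ.powersetCard t, (up^[t - j] p) U * A U b) ^ 2 =
      kernelEigen n t j κ * ip (up^[t - j] p) (up^[t - j] p) := by
  rw [← sum_kernel_ladder hjt hp (up^[t - j] p) κ]
  simp_rw [sq, sum_mul_sum]
  rw [sum_comm]
  refine sum_congr rfl fun U hU => ?_
  rw [sum_comm]
  refine sum_congr rfl fun U' hU' => ?_
  rw [← hA U hU U' hU', sum_mul, mul_sum]
  refine sum_congr rfl fun b _ => ?_
  ring

/-- **Gram kernels on a ladder decomposition**: with `A` as above and
`f = Σ_{j ≤ t} (Wᵀ)^{t−j} p_j` (`p_j` harmonic of degree `j`),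
`‖Aᵀ f‖² = Σ_b (Σ_{|U|=t} f(U) A(U,b))² = Σ_j kernelEigen n t j κ · (Π_{i<t−j} λ_j(i)) · ⟪p_j, p_j⟫` —
the layers do not interact, and the top singular value of `Aᵀ` off the constants is
`max_{j ≥ 1} √(kernelEigen n t j κ)` (the second-eigenvalue entry point).
[cite: MacWilliamsSloane1977, Ch. 21 §6 Thm. 10 with Problem (11) (C_i = A_i A_iᵀ ∈ 𝒜; PDF p. 516)] -/
theorem sum_sq_gram_ladderDecomposition {β : Type*} [Fintype β] {t : ℕ}
    (A : Finset (Fin n) → β → ℝ) (κ : ℕ → ℝ)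
    (hA : ∀ U ∈ univ.powersetCard t, ∀ U' ∈ univ.powersetCard t,
      ∑ b, A U b * A U' b = κ (U ∩ U').card)
    (p : ℕ → Finset (Fin n) → ℝ) (hp : ∀ j, IsHarmonic j (p j)) :
    ∑ b, (∑ U ∈ univ.powersetCard t, (∑ j ∈ range (t + 1), up^[t - j] (p j)) U * A U b) ^ 2 =
      ∑ j ∈ range (t + 1),
        kernelEigen n t j κ * ((∏ i ∈ range (t - j), ladder n j i) * ip (p j) (p j)) := by
  rw [← sum_kernel_ladderDecomposition p hp κ]
  simp_rw [sq, sum_mul_sum]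
  rw [sum_comm]
  refine sum_congr rfl fun U hU => ?_
  rw [sum_comm]
  refine sum_congr rfl fun U' hU' => ?_
  rw [← hA U hU U' hU', sum_mul, mul_sum]
  refine sum_congr rfl fun b _ => ?_
  ring

/-! ### §7 Spectral bounds: Parseval on `t`-sets, Rayleigh quotients off the constants, and the
zero-rectangle mixing inequality for Gram kernels (appended) -/

/-- The ladder norm factor `Π_{i < t−j} λ_j(i)` of the layer `(Wᵀ)^{t−j} Ker W_j ⊆ L_t` is
nonnegative in the range `2t ≤ n + 1`, `j ≤ t` (each factor `(i+1)(n − 2j − i)` has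
`2j + i ≤ 2t − 1 ≤ n`).
[cite: LeePrakashDewolfYuen2016, App. B Thm. B.1 / Lemma B.8 (Johnson-scheme spectrum; arXiv text chunks 19, 21)] -/
theorem ladderProd_range_nonneg {t j : ℕ} (hjt : j ≤ t) (ht : 2 * t ≤ n + 1) :
    0 ≤ ∏ i ∈ range (t - j), ladder n j i := by
  refine prod_nonneg fun i hi => ?_
  have hi' := mem_range.1 hi
  unfold ladder
  have h1 : (0 : ℝ) ≤ (i : ℝ) + 1 := by positivity
  have h2 : (0 : ℝ) ≤ (n : ℝ) - 2 * j - i := by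
    have hle : 2 * j + i ≤ n := by omega
    have hle' : ((2 * j + i : ℕ) : ℝ) ≤ (n : ℝ) := by exact_mod_cast hle
    push_cast at hle'
    linarith
  exact mul_nonneg h1 h2

/-- A ladder sum `Σ_{j ≤ t} (Wᵀ)^{t−j} p_j` (`p_j` harmonic of degree `j`) lies in `L_t`.
[cite: LeePrakashDewolfYuen2016, App. B Thm. B.5, Cor. B.6 (arXiv text chunk 20)] -/
theorem isHomog_ladderSum {t : ℕ} (p : ℕ → Finset (Fin n) → ℝ) (hp : ∀ j, IsHarmonic j (p j)) :
    IsHomog t (∑ j ∈ range (t + 1), up^[t - j] (p j)) := by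
  refine IsHomog.sum _ fun j hj => ?_
  have hjt : j ≤ t := by have := mem_range.1 hj; omega
  have h := isHomog_iterate_up (hp j).1 (t - j)
  rwa [Nat.add_sub_cancel' hjt] at h

/-- **Parseval on a ladder decomposition** (coefficient pairing): for `f = Σ_{j ≤ t} (Wᵀ)^{t−j} p_j`
with `p_j` harmonic of degree `j`, `⟪f, f⟫ = Σ_j (Π_{i<t−j} λ_j(i)) ⟪p_j, p_j⟫` — the layers
`V_0, …, V_t` are pairwise orthogonal.
[cite: MacWilliamsSloane1977, Ch. 21 §6 Thm. 10 (orthogonal eigenspaces V_0, …, V_t of the Johnson scheme; PDF p. 516)] -/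
theorem ip_ladderSum_self {t : ℕ} (p : ℕ → Finset (Fin n) → ℝ) (hp : ∀ j, IsHarmonic j (p j)) :
    ip (∑ j ∈ range (t + 1), up^[t - j] (p j)) (∑ j ∈ range (t + 1), up^[t - j] (p j)) =
      ∑ j ∈ range (t + 1), (∏ i ∈ range (t - j), ladder n j i) * ip (p j) (p j) := by
  rw [ip_sum_left]
  refine sum_congr rfl fun j hj => ?_
  have hjt : j ≤ t := by have := mem_range.1 hj; omega
  rw [ip_sum_right, sum_eq_single_of_mem j hj fun j' hj' hne => ?_, ip_iterate_up_of_isHarmonic (hp j)]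
  have hj't : j' ≤ t := by have := mem_range.1 hj'; omega
  rcases lt_or_gt_of_ne hne with h | h
  · -- `j' < j`: the ladder over `p j'` is longer by `j − j' ≥ 1`
    rw [show t - j' = (t - j) + (j - j') by omega]
    exact ip_iterate_up_cross (hp j') (hp j).2 (by omega) _
  · rw [ip_comm, show t - j = (t - j') + (j' - j) by omega]
    exact ip_iterate_up_cross (hp j) (hp j').2 (by omega) _

/-- **Parseval on `t`-sets**: `Σ_{|U| = t} f(U)² = Σ_j (Π_{i<t−j} λ_j(i)) ⟪p_j, p_j⟫` for a ladder
sum `f` as above.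
[cite: MacWilliamsSloane1977, Ch. 21 §6 Thm. 10 (orthogonal eigenspaces V_0, …, V_t of the Johnson scheme; PDF p. 516)] -/
theorem sum_sq_ladderSum {t : ℕ} (p : ℕ → Finset (Fin n) → ℝ) (hp : ∀ j, IsHarmonic j (p j)) :
    ∑ U ∈ univ.powersetCard t, (∑ j ∈ range (t + 1), up^[t - j] (p j)) U ^ 2 =
      ∑ j ∈ range (t + 1), (∏ i ∈ range (t - j), ladder n j i) * ip (p j) (p j) := by
  rw [← ip_ladderSum_self p hp, ← sum_powersetCard_mul_of_isHomog _ (isHomog_ladderSum p hp)]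
  exact sum_congr rfl fun U _ => sq _

/-- The constant layer evaluated: for `p₀` homogeneous of degree `0` and `|U| = t`,
`((Wᵀ)^t p₀)(U) = t! · p₀(∅)`.
[cite: LeePrakashDewolfYuen2016, App. B §B.1 (operators W_t, eq. (B.1)–(B.2); arXiv text chunk 19)] -/
theorem iterate_up_apply_of_degree_zero {t : ℕ} {p₀ : Finset (Fin n) → ℝ} (hp : IsHomog 0 p₀)
    {U : Finset (Fin n)} (hU : U.card = t) :
    (up^[t] p₀) U = (t.factorial : ℝ) * p₀ ∅ := by
  rw [iterate_up_apply_of_isHomog hp (m := t) (by rw [hU, zero_add]), zeta_apply,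
    sum_eq_single_of_mem ∅ (empty_mem_powerset U) fun T _ hT => hp T fun h => hT (card_eq_zero.1 h)]

/-- **The mass of the constant layer is the squared mean**: for a ladder sum
`f = Σ_{j ≤ t} (Wᵀ)^{t−j} p_j`, `(Π_{i<t} λ_0(i)) ⟪p_0, p_0⟫ = t! · p_0(∅) · Σ_{|U| = t} f(U)`
(pair `f` with the constant vector `(Wᵀ)^t p_0 = t!·p_0(∅)·𝟙` and use orthogonality of the layers).
[cite: BrouwerHaemers2012, Prop. 4.3.2 proof (coefficient of the all-ones eigenvector α₁ = s/√n; PDF p. 83)] -/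
theorem ladder_zero_mass_eq {t : ℕ} (p : ℕ → Finset (Fin n) → ℝ) (hp : ∀ j, IsHarmonic j (p j)) :
    (∏ i ∈ range t, ladder n 0 i) * ip (p 0) (p 0) =
      (t.factorial : ℝ) * (p 0) ∅ *
        ∑ U ∈ univ.powersetCard t, (∑ j ∈ range (t + 1), up^[t - j] (p j)) U := by
  have hv0 : IsHomog t (up^[t] (p 0)) := by
    have h := isHomog_iterate_up (hp 0).1 t
    rwa [zero_add] at h
  -- pair the ladder sum with the constant ladder `(Wᵀ)^t p₀`: only the layer `j = 0` survives
  have h1 : ip (∑ j ∈ range (t + 1), up^[t - j] (p j)) (up^[t] (p 0)) =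
      (∏ i ∈ range t, ladder n 0 i) * ip (p 0) (p 0) := by
    rw [ip_sum_left, sum_eq_single_of_mem 0 (mem_range.2 (Nat.succ_pos t)) fun j' hj' hne => ?_,
      Nat.sub_zero, ip_iterate_up_of_isHarmonic (hp 0)]
    have hj't : j' ≤ t := by have := mem_range.1 hj'; omega
    have hsplit : up^[t] (p 0) = up^[(t - j') + j'] (p 0) := by rw [Nat.sub_add_cancel hj't]
    rw [hsplit]
    exact ip_iterate_up_cross (hp 0) (hp j').2 (by omega) _
  -- and pointwise the constant ladder is `t! · p₀(∅)`
  have h2 : ip (∑ j ∈ range (t + 1), up^[t - j] (p j)) (up^[t] (p 0)) =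
      (t.factorial : ℝ) * (p 0) ∅ *
        ∑ U ∈ univ.powersetCard t, (∑ j ∈ range (t + 1), up^[t - j] (p j)) U := by
    rw [← sum_powersetCard_mul_of_isHomog _ hv0, mul_sum]
    refine sum_congr rfl fun U hU => ?_
    rw [iterate_up_apply_of_degree_zero (hp 0).1 (mem_powersetCard_univ.1 hU)]
    ring
  rw [← h1, h2]

/-- Zero mean on `t`-sets kills the constant layer: `Σ_{|U|=t} f(U) = 0` ⇒
`(Π_{i<t} λ_0(i)) ⟪p_0, p_0⟫ = 0`.
[cite: BrouwerHaemers2012, Prop. 4.3.2 proof (Σ_{i>1} α_i² = (χ_S, χ_S) − s²/n; PDF p. 83)] -/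
theorem ladder_zero_mass_eq_zero {t : ℕ} (p : ℕ → Finset (Fin n) → ℝ) (hp : ∀ j, IsHarmonic j (p j))
    (h0 : ∑ U ∈ univ.powersetCard t, (∑ j ∈ range (t + 1), up^[t - j] (p j)) U = 0) :
    (∏ i ∈ range t, ladder n 0 i) * ip (p 0) (p 0) = 0 := by
  rw [ladder_zero_mass_eq p hp, h0, mul_zero]

/-- **Rayleigh bound for a kernel on a ladder sum**: if every ladder eigenvalue of the kernel
`k(|U ∩ U'|)` on `L_t` is `≤ Λ` (`2t ≤ n + 1`), then `⟨f, K f⟩ ≤ Λ · Σ_{|U|=t} f(U)²`.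
[cite: MacWilliamsSloane1977, Ch. 21 §6 Thm. 10 (common eigenspaces of the Bose–Mesner algebra; PDF p. 516)] -/
theorem sum_kernel_ladderSum_le {t : ℕ} (ht : 2 * t ≤ n + 1) (p : ℕ → Finset (Fin n) → ℝ)
    (hp : ∀ j, IsHarmonic j (p j)) (k : ℕ → ℝ) {Λ : ℝ} (hΛ : ∀ j, j ≤ t → kernelEigen n t j k ≤ Λ) :
    ∑ U ∈ univ.powersetCard t, ∑ U' ∈ univ.powersetCard t,
        (∑ j ∈ range (t + 1), up^[t - j] (p j)) U *
          (k (U ∩ U').card * (∑ j ∈ range (t + 1), up^[t - j] (p j)) U') ≤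
      Λ * ∑ U ∈ univ.powersetCard t, (∑ j ∈ range (t + 1), up^[t - j] (p j)) U ^ 2 := by
  rw [sum_kernel_ladderDecomposition p hp k, sum_sq_ladderSum p hp, mul_sum]
  refine sum_le_sum fun j hj => ?_
  have hjt : j ≤ t := by have := mem_range.1 hj; omega
  exact mul_le_mul_of_nonneg_right (hΛ j hjt)
    (mul_nonneg (ladderProd_range_nonneg hjt ht) (ip_self_nonneg _))

/-- **Rayleigh bound off the constants**: if `Σ_{|U|=t} f(U) = 0` then only the eigenvalues on
`V_1, …, V_t` matter: `kernelEigen n t j k ≤ Λ` for `1 ≤ j ≤ t` gives `⟨f, K f⟩ ≤ Λ · Σ_{|U|=t} f(U)²`.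
[cite: BrouwerHaemers2012, Prop. 4.3.2 (expander mixing lemma, Alon–Chung; PDF p. 83)] -/
theorem sum_kernel_ladderSum_le_of_sum_eq_zero {t : ℕ} (ht : 2 * t ≤ n + 1)
    (p : ℕ → Finset (Fin n) → ℝ) (hp : ∀ j, IsHarmonic j (p j)) (k : ℕ → ℝ) {Λ : ℝ}
    (hΛ : ∀ j, 1 ≤ j → j ≤ t → kernelEigen n t j k ≤ Λ)
    (h0 : ∑ U ∈ univ.powersetCard t, (∑ j ∈ range (t + 1), up^[t - j] (p j)) U = 0) :
    ∑ U ∈ univ.powersetCard t, ∑ U' ∈ univ.powersetCard t,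
        (∑ j ∈ range (t + 1), up^[t - j] (p j)) U *
          (k (U ∩ U').card * (∑ j ∈ range (t + 1), up^[t - j] (p j)) U') ≤
      Λ * ∑ U ∈ univ.powersetCard t, (∑ j ∈ range (t + 1), up^[t - j] (p j)) U ^ 2 := by
  rw [sum_kernel_ladderDecomposition p hp k, sum_sq_ladderSum p hp, mul_sum]
  refine sum_le_sum fun j hj => ?_
  have hjt : j ≤ t := by have := mem_range.1 hj; omega
  rcases Nat.eq_zero_or_pos j with rfl | hj1
  · rw [Nat.sub_zero, ladder_zero_mass_eq_zero p hp h0, mul_zero, mul_zero]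
  · exact mul_le_mul_of_nonneg_right (hΛ j hj1 hjt)
      (mul_nonneg (ladderProd_range_nonneg hjt ht) (ip_self_nonneg _))

/-- **Rayleigh bound for a kernel, intrinsic form**: for `f ∈ L_t` (`2t ≤ n + 1`) with
`Σ_{|U|=t} f(U) = 0` and a kernel whose ladder eigenvalues on `V_1, …, V_t` are `≤ Λ`,
`Σ_{U,U'} f(U) k(|U ∩ U'|) f(U') ≤ Λ · Σ_{|U|=t} f(U)²`.
[cite: BrouwerHaemers2012, Prop. 4.3.2 (expander mixing lemma, Alon–Chung; PDF p. 83)] -/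
theorem sum_kernel_le_of_sum_eq_zero {t : ℕ} (ht : 2 * t ≤ n + 1) {f : Finset (Fin n) → ℝ}
    (hf : IsHomog t f) (h0 : ∑ U ∈ univ.powersetCard t, f U = 0) (k : ℕ → ℝ) {Λ : ℝ}
    (hΛ : ∀ j, 1 ≤ j → j ≤ t → kernelEigen n t j k ≤ Λ) :
    ∑ U ∈ univ.powersetCard t, ∑ U' ∈ univ.powersetCard t, f U * (k (U ∩ U').card * f U') ≤
      Λ * ∑ U ∈ univ.powersetCard t, f U ^ 2 := by
  obtain ⟨p, hp, rfl⟩ := exists_ladder_decomposition ht hf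
  exact sum_kernel_ladderSum_le_of_sum_eq_zero ht p hp k hΛ h0

/-- **One layer against an arbitrary test vector** (Cauchy–Schwarz with §6): for `p` harmonic of
degree `j ≤ t`, `A` with Gram kernel `κ(|U ∩ U'|)` on `t`-sets and any `g : β → ℝ`,
`(Σ_b (Σ_{|U|=t} ((Wᵀ)^{t−j} p)(U) A(U,b)) · g(b))² ≤ kernelEigen n t j κ · ⟪(Wᵀ)^{t−j} p, (Wᵀ)^{t−j} p⟫ · Σ_b g(b)²`.
[cite: BrouwerHaemers2012, Prop. 4.3.2 proof (|Σ_{i>1} α_i β_i θ_i| ≤ λ Σ |α_i β_i|; PDF p. 83)] -/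
theorem sq_sum_gram_ladder_mul_le {β : Type*} [Fintype β] {t j : ℕ} (hjt : j ≤ t)
    (A : Finset (Fin n) → β → ℝ) (κ : ℕ → ℝ)
    (hA : ∀ U ∈ univ.powersetCard t, ∀ U' ∈ univ.powersetCard t,
      ∑ b, A U b * A U' b = κ (U ∩ U').card)
    {p : Finset (Fin n) → ℝ} (hp : IsHarmonic j p) (g : β → ℝ) :
    (∑ b, (∑ U ∈ univ.powersetCard t, (up^[t - j] p) U * A U b) * g b) ^ 2 ≤
      kernelEigen n t j κ * ip (up^[t - j] p) (up^[t - j] p) * ∑ b, g b ^ 2 := by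
  rw [← sum_sq_gram_ladder hjt A κ hA hp]
  exact sum_mul_sq_le_sq_mul_sq _ _ _

/-- **Second-eigenvalue bound for Gram kernels on a ladder sum**: with `A Aᵀ` in the Bose–Mesner
algebra of `J(n,t)` (Gram kernel `κ`), `2t ≤ n + 1`, `Σ_{|U|=t} f(U) = 0` and
`kernelEigen n t j κ ≤ Λ` for `1 ≤ j ≤ t`: `‖Aᵀ f‖² = Σ_b (Σ_U f(U) A(U,b))² ≤ Λ · Σ_{|U|=t} f(U)²`.
[cite: BrouwerHaemers2012, Prop. 4.3.2 (expander mixing lemma, Alon–Chung; PDF p. 83)] -/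
theorem sum_sq_gram_ladderSum_le_of_sum_eq_zero {β : Type*} [Fintype β] {t : ℕ} (ht : 2 * t ≤ n + 1)
    (A : Finset (Fin n) → β → ℝ) (κ : ℕ → ℝ)
    (hA : ∀ U ∈ univ.powersetCard t, ∀ U' ∈ univ.powersetCard t,
      ∑ b, A U b * A U' b = κ (U ∩ U').card)
    (p : ℕ → Finset (Fin n) → ℝ) (hp : ∀ j, IsHarmonic j (p j)) {Λ : ℝ}
    (hΛ : ∀ j, 1 ≤ j → j ≤ t → kernelEigen n t j κ ≤ Λ)
    (h0 : ∑ U ∈ univ.powersetCard t, (∑ j ∈ range (t + 1), up^[t - j] (p j)) U = 0) :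
    ∑ b, (∑ U ∈ univ.powersetCard t, (∑ j ∈ range (t + 1), up^[t - j] (p j)) U * A U b) ^ 2 ≤
      Λ * ∑ U ∈ univ.powersetCard t, (∑ j ∈ range (t + 1), up^[t - j] (p j)) U ^ 2 := by
  rw [sum_sq_gram_ladderDecomposition A κ hA p hp, sum_sq_ladderSum p hp, mul_sum]
  refine sum_le_sum fun j hj => ?_
  have hjt : j ≤ t := by have := mem_range.1 hj; omega
  rcases Nat.eq_zero_or_pos j with rfl | hj1
  · rw [Nat.sub_zero, ladder_zero_mass_eq_zero p hp h0, mul_zero, mul_zero]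
  · exact mul_le_mul_of_nonneg_right (hΛ j hj1 hjt)
      (mul_nonneg (ladderProd_range_nonneg hjt ht) (ip_self_nonneg _))

/-- **Second-eigenvalue bound for Gram kernels, intrinsic form**: for `f ∈ L_t` (`2t ≤ n + 1`)
with `Σ_{|U|=t} f(U) = 0` and `A` whose Gram kernel on `t`-sets is a class function `κ(|U ∩ U'|)`
with `kernelEigen n t j κ ≤ Λ` for `1 ≤ j ≤ t`: `Σ_b (Σ_{|U|=t} f(U) A(U,b))² ≤ Λ · Σ_{|U|=t} f(U)²`
(the top singular value of `Aᵀ` off the constants is at most `√Λ`).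
[cite: BrouwerHaemers2012, Prop. 4.3.2 (expander mixing lemma, Alon–Chung; PDF p. 83)] -/
theorem sum_sq_gram_le_of_sum_eq_zero {β : Type*} [Fintype β] {t : ℕ} (ht : 2 * t ≤ n + 1)
    (A : Finset (Fin n) → β → ℝ) (κ : ℕ → ℝ)
    (hA : ∀ U ∈ univ.powersetCard t, ∀ U' ∈ univ.powersetCard t,
      ∑ b, A U b * A U' b = κ (U ∩ U').card)
    {f : Finset (Fin n) → ℝ} (hf : IsHomog t f) (h0 : ∑ U ∈ univ.powersetCard t, f U = 0) {Λ : ℝ}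
    (hΛ : ∀ j, 1 ≤ j → j ≤ t → kernelEigen n t j κ ≤ Λ) :
    ∑ b, (∑ U ∈ univ.powersetCard t, f U * A U b) ^ 2 ≤ Λ * ∑ U ∈ univ.powersetCard t, f U ^ 2 := by
  obtain ⟨p, hp, rfl⟩ := exists_ladder_decomposition ht hf
  exact sum_sq_gram_ladderSum_le_of_sum_eq_zero ht A κ hA p hp hΛ h0

/-- **Zero-rectangle mixing bound** (Haemers' inequality for incidence structures, the case of a
substructure WITHOUT flags, in ladder form). Let `A` be a real matrix on (`t`-sets of an `n`-set) × `β`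
with `2t ≤ n + 1`, whose Gram kernel on `t`-sets is a class function, `Σ_b A(U,b) A(U',b) = κ(|U ∩ U'|)`,
and whose column sums over the `t`-sets are constant, `Σ_{|U|=t} A(U,b) = d_C`; let `Λ ≥ 0` bound the
ladder eigenvalues `kernelEigen n t j κ` for `1 ≤ j ≤ t` (the squared singular values of `Aᵀ` off the
constants). If `X` is a family of `t`-sets and `Y ⊆ β` with `Σ_{U ∈ X} Σ_{b ∈ Y} A(U,b) = 0` (for
`A ≥ 0`: `A` vanishes on the rectangle `X × Y`), then
`|X| · |Y| · d_C² ≤ Λ · C(n,t) · (C(n,t) − |X|)`.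
With `λ₀ := d_R d_C` the top eigenvalue of `A Aᵀ` (`d_R` = the row sums, constant as well since
`Σ_{U'} κ(|U ∩ U'|) = d_C d_R`) and densities `μ = |X|/C(n,t)`, `ν = |Y|/|β|`, this reads
`μ ν ≤ (1 − μ) · Λ/λ₀` — "a rectangle free of incidences has density product at most (σ₂/σ₁)²".
The printed theorem (Haemers 1978/1995; for 1-designs) has the symmetric extra factor `(1 − ν)` and is
proved by eigenvalue interlacing of a quotient matrix; the one-sided form here follows the
Cauchy–Schwarz proof of the expander mixing lemma with the test vector `C(n,t)·𝟙_X − |X|·𝟙` and needs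
only COLUMN regularity; with row regularity as well the two-sided form is
`card_mul_card_mul_sq_le_of_sum_eq_zero_of_biregular` (§7 continued). (BH Thm. 4.9.1 for general `m'`
— rectangles with flags — is not formalised.)
[cite: BrouwerHaemers2012, Thm. 4.9.1 (case m' = 0: b'k · v'r ≤ θ₂² (v − v')(b − b'); PDF p. 93) and Prop. 4.3.2 (PDF p. 83)] -/
theorem card_mul_card_mul_sq_le_of_sum_eq_zero {β : Type*} [Fintype β] {t : ℕ} (ht : 2 * t ≤ n + 1)
    (A : Finset (Fin n) → β → ℝ) (κ : ℕ → ℝ)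
    (hA : ∀ U ∈ univ.powersetCard t, ∀ U' ∈ univ.powersetCard t,
      ∑ b, A U b * A U' b = κ (U ∩ U').card)
    {dC : ℝ} (hcol : ∀ b, ∑ U ∈ univ.powersetCard t, A U b = dC)
    {Λ : ℝ} (hΛ0 : 0 ≤ Λ) (hΛ : ∀ j, 1 ≤ j → j ≤ t → kernelEigen n t j κ ≤ Λ)
    (X : Finset (Finset (Fin n))) (hX : X ⊆ univ.powersetCard t) (Y : Finset β)
    (hXY : ∑ U ∈ X, ∑ b ∈ Y, A U b = 0) :
    (X.card : ℝ) * Y.card * dC ^ 2 ≤ Λ * (n.choose t : ℝ) * ((n.choose t : ℝ) - X.card) := by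
  classical
  set P : Finset (Finset (Fin n)) := univ.powersetCard t with hP
  have hPcard : (P.card : ℝ) = (n.choose t : ℝ) := by
    rw [hP, card_powersetCard, card_univ, Fintype.card_fin]
  set N : ℝ := (n.choose t : ℝ) with hN
  have hXN : (X.card : ℝ) ≤ N := by
    rw [← hPcard]; exact_mod_cast card_le_card hX
  -- the test vector `h = N·𝟙_X − |X|·𝟙` on the `t`-sets
  set h : Finset (Fin n) → ℝ :=
    fun U => if U.card = t then N * (if U ∈ X then 1 else 0) - X.card else 0 with hh
  have hhom : IsHomog t h := fun U hU => by simp only [hh, hU, if_false]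
  have hval : ∀ U ∈ P, h U = N * (if U ∈ X then 1 else 0) - X.card := fun U hU => by
    simp only [hh, mem_powersetCard_univ.1 hU, if_true]
  have hind : ∀ (F : Finset (Fin n) → ℝ),
      ∑ U ∈ P, (if U ∈ X then 1 else 0) * F U = ∑ U ∈ X, F U := by
    intro F
    rw [← sum_subset hX fun U _ hUX => by rw [if_neg hUX, zero_mul]]
    exact sum_congr rfl fun U hU => by rw [if_pos hU, one_mul]
  -- zero mean
  have hsum0 : ∑ U ∈ P, h U = 0 := by
    rw [sum_congr rfl hval, sum_sub_distrib, ← mul_sum, sum_const, nsmul_eq_mul, hPcard]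
    have h1 : ∑ U ∈ P, (if U ∈ X then (1 : ℝ) else 0) = X.card := by
      have := hind fun _ => 1
      simp only [mul_one, sum_const, nsmul_eq_mul] at this
      rw [this]
    rw [h1]
    ring
  -- squared norm `|X|(N − |X|)² + (N − |X|)|X|² = |X| (N − |X|) N`
  have hnorm : ∑ U ∈ P, h U ^ 2 = X.card * (N - X.card) * N := by
    rw [sum_congr rfl fun U hU => by rw [hval U hU], ← sum_sdiff hX]
    have hin : ∑ U ∈ X, (N * (if U ∈ X then 1 else 0) - X.card) ^ 2 = X.card * (N - X.card) ^ 2 := by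
      rw [sum_congr rfl fun U hU => by rw [if_pos hU, mul_one], sum_const, nsmul_eq_mul]
    have hout : ∑ U ∈ P \ X, (N * (if U ∈ X then 1 else 0) - X.card) ^ 2 = (N - X.card) * X.card ^ 2 := by
      rw [sum_congr rfl fun U hU => by rw [if_neg (mem_sdiff.1 hU).2, mul_zero, zero_sub],
        sum_const, nsmul_eq_mul, card_sdiff_of_subset hX, Nat.cast_sub (card_le_card hX), hPcard]
      ring
    rw [hin, hout]
    ring
  -- `(Aᵀ h)(b) = N · Σ_{U ∈ X} A(U,b) − |X| d_C`
  have hAh : ∀ b, ∑ U ∈ P, h U * A U b = N * ∑ U ∈ X, A U b - X.card * dC := by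
    intro b
    rw [sum_congr rfl fun U hU => by rw [hval U hU], ← hind fun U => A U b, ← hcol b, mul_sum, mul_sum,
      ← sum_sub_distrib]
    exact sum_congr rfl fun U _ => by ring
  -- summed over `Y`: the rectangle term vanishes
  have hY : ∑ b ∈ Y, ∑ U ∈ P, h U * A U b = -(X.card * dC * Y.card) := by
    rw [sum_congr rfl fun b _ => hAh b, sum_sub_distrib, ← mul_sum, sum_comm, hXY, mul_zero, zero_sub,
      sum_const, nsmul_eq_mul]
    ring
  -- Cauchy–Schwarz over `Y`, then enlarge to all of `β`
  have hCS : (X.card * dC * Y.card) ^ 2 ≤ Y.card * ∑ b, (∑ U ∈ P, h U * A U b) ^ 2 := by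
    have h1 := sum_mul_sq_le_sq_mul_sq Y (fun _ => (1 : ℝ)) (fun b => ∑ U ∈ P, h U * A U b)
    simp only [one_mul, one_pow, sum_const, nsmul_eq_mul, mul_one] at h1
    rw [hY, neg_sq] at h1
    refine h1.trans (mul_le_mul_of_nonneg_left ?_ (Nat.cast_nonneg _))
    exact sum_le_univ_sum_of_nonneg fun b => sq_nonneg _
  -- the spectral bound off the constants
  have hspec : ∑ b, (∑ U ∈ P, h U * A U b) ^ 2 ≤ Λ * (X.card * (N - X.card) * N) := by
    rw [← hnorm]
    exact sum_sq_gram_le_of_sum_eq_zero ht A κ hA hhom hsum0 hΛ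
  have key : (X.card : ℝ) * Y.card * ((X.card : ℝ) * Y.card * dC ^ 2) ≤
      (X.card : ℝ) * Y.card * (Λ * N * (N - X.card)) := by
    have h2 : (X.card * dC * Y.card) ^ 2 ≤ Y.card * (Λ * (X.card * (N - X.card) * N)) :=
      hCS.trans (mul_le_mul_of_nonneg_left hspec (Nat.cast_nonneg _))
    calc (X.card : ℝ) * Y.card * ((X.card : ℝ) * Y.card * dC ^ 2)
        = (X.card * dC * Y.card) ^ 2 := by ring
      _ ≤ Y.card * (Λ * (X.card * (N - X.card) * N)) := h2
      _ = (X.card : ℝ) * Y.card * (Λ * N * (N - X.card)) := by ring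
  by_cases hXY0 : (X.card : ℝ) * Y.card = 0
  · rw [hXY0, zero_mul]
    exact mul_nonneg (mul_nonneg hΛ0 (Nat.cast_nonneg _)) (sub_nonneg.2 hXN)
  · have hpos : 0 < (X.card : ℝ) * Y.card :=
      lt_of_le_of_ne (mul_nonneg (Nat.cast_nonneg _) (Nat.cast_nonneg _)) (Ne.symm hXY0)
    exact le_of_mul_le_mul_left key hpos

/-! ### §8 Degree truncation on the slice: harmonic layers versus polynomials of bounded `x`-degree
(appended) -/

/-- **Layers `V_j`, `j ≥ 1`, have zero mean on the slice**: for `p` harmonic of degree `j`,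
`1 ≤ j ≤ t`, `Σ_{|U| = t} ((Wᵀ)^{t−j} p)(U) = 0` (the layer is orthogonal to the constant ladder
`(Wᵀ)^t δ_∅ = t!·𝟙`).
[cite: MacWilliamsSloane1977, Ch. 21 §6 Thm. 10 (V_0 = constants is one of the orthogonal eigenspaces; PDF p. 516)] -/
theorem sum_powersetCard_ladder_eq_zero {t j : ℕ} (hj : 1 ≤ j) (hjt : j ≤ t)
    {p : Finset (Fin n) → ℝ} (hp : IsHarmonic j p) :
    ∑ U ∈ univ.powersetCard t, (up^[t - j] p) U = 0 := by
  have h0 : IsHomog 0 (delta (∅ : Finset (Fin n))) := by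
    have h := isHomog_delta (∅ : Finset (Fin n))
    rwa [card_empty] at h
  have hq : IsHarmonic 0 (delta (∅ : Finset (Fin n))) := isHarmonic_of_isHomog_zero h0
  have hv : IsHomog t (up^[t] (delta (∅ : Finset (Fin n)))) := by
    have h := isHomog_iterate_up h0 t
    rwa [zero_add] at h
  have hconst : ∀ U ∈ univ.powersetCard t,
      (up^[t] (delta (∅ : Finset (Fin n)))) U = (t.factorial : ℝ) := by
    intro U hU
    rw [iterate_up_apply_of_degree_zero h0 (mem_powersetCard_univ.1 hU)]
    simp [delta]
  have horth : ip (up^[t - j] p) (up^[t] (delta (∅ : Finset (Fin n)))) = 0 := by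
    have hsplit : up^[t] (delta (∅ : Finset (Fin n))) = up^[(t - j) + j] (delta ∅) := by
      rw [Nat.sub_add_cancel hjt]
    rw [hsplit]
    exact ip_iterate_up_cross hq hp.2 hj _
  have hsum : (∑ U ∈ univ.powersetCard t, (up^[t - j] p) U) * (t.factorial : ℝ) = 0 := by
    rw [sum_mul, ← horth, ← sum_powersetCard_mul_of_isHomog _ hv]
    exact sum_congr rfl fun U hU => by rw [hconst U hU]
  exact (mul_eq_zero.1 hsum).resolve_right (Nat.cast_ne_zero.2 (Nat.factorial_ne_zero t))

/-- A ladder sum WITHOUT constant layer has zero mean on the slice: if `p_0 = 0` then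
`Σ_{|U| = t} (Σ_{j ≤ t} (Wᵀ)^{t−j} p_j)(U) = 0` — so the off-constants bounds of §7 apply to it.
[cite: BrouwerHaemers2012, Prop. 4.3.2 proof (the component orthogonal to the all-ones vector; PDF p. 83)] -/
theorem sum_powersetCard_ladderSum_eq_zero {t : ℕ} (p : ℕ → Finset (Fin n) → ℝ)
    (hp : ∀ j, IsHarmonic j (p j)) (hp0 : p 0 = 0) :
    ∑ U ∈ univ.powersetCard t, (∑ j ∈ range (t + 1), up^[t - j] (p j)) U = 0 := by
  simp_rw [Finset.sum_apply]
  rw [sum_comm]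
  refine sum_eq_zero fun j hj => ?_
  have hjt : j ≤ t := by have := mem_range.1 hj; omega
  rcases Nat.eq_zero_or_pos j with rfl | hj1
  · rw [hp0, iterate_up_zero_vec]
    exact sum_eq_zero fun _ _ => rfl
  · exact sum_powersetCard_ladder_eq_zero hj1 hjt (hp j)

/-- **Ladder = factorial × cube evaluation on the slice**: for `p ∈ L_j`, `j ≤ t`, `|U| = t`,
`((Wᵀ)^{t−j} p)(U) = (t−j)! · zeta p (U)` (`zeta p (U) = Σ_{T ⊆ U} p(T)` is the multilinear
polynomial with coefficient vector `p` evaluated at `𝟙_U`).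
[cite: Grigoriev2001, §2 eq. (2.1) (PDF p. 9)] -/
theorem ladder_apply_eq_factorial_mul_zeta {t j : ℕ} (hjt : j ≤ t) {p : Finset (Fin n) → ℝ}
    (hp : IsHomog j p) {U : Finset (Fin n)} (hU : U.card = t) :
    (up^[t - j] p) U = ((t - j).factorial : ℝ) * zeta p U :=
  iterate_up_apply_of_isHomog hp (by rw [hU, Nat.add_sub_cancel' hjt])

/-- **A ladder sum is a polynomial on the slice**: for `|U| = t`,
`(Σ_{j ≤ t} (Wᵀ)^{t−j} p_j)(U) = zeta (Σ_{j ≤ t} (t−j)! · p_j)(U)` — the coefficient vector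
`Σ_j (t−j)!·p_j` has `x`-degree `≤ K` as soon as the layers `j > K` vanish (next statement).
[cite: MacWilliamsSloane1977, Ch. 21 §6 Thm. 10 with Problem (11) (V_0 ⊕ … ⊕ V_i = column space of the i-sets inclusion matrix A_i; PDF p. 516)] -/
theorem ladderSum_apply_eq_zeta {t : ℕ} (p : ℕ → Finset (Fin n) → ℝ) (hp : ∀ j, IsHarmonic j (p j))
    {U : Finset (Fin n)} (hU : U.card = t) :
    (∑ j ∈ range (t + 1), up^[t - j] (p j)) U =
      zeta (∑ j ∈ range (t + 1), ((t - j).factorial : ℝ) • p j) U := by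
  rw [Finset.sum_apply, map_sum, Finset.sum_apply]
  refine sum_congr rfl fun j hj => ?_
  have hjt : j ≤ t := by have := mem_range.1 hj; omega
  rw [map_smul, Pi.smul_apply, smul_eq_mul, ladder_apply_eq_factorial_mul_zeta hjt (hp j).1 hU]

/-- The coefficient vector of a ladder sum whose layers `j > K` vanish is supported on sets of size
`≤ K` (it is a polynomial of `x`-degree `≤ K`).
[cite: MacWilliamsSloane1977, Ch. 21 §6 Thm. 10 with Problem (11) (V_0 ⊕ … ⊕ V_i = column space of A_i; PDF p. 516)] -/
theorem ladderCoeff_eq_zero_of_lt_card {t K : ℕ} (p : ℕ → Finset (Fin n) → ℝ)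
    (hp : ∀ j, IsHarmonic j (p j)) (hK : ∀ j, K < j → p j = 0) {T : Finset (Fin n)} (hT : K < T.card) :
    (∑ j ∈ range (t + 1), ((t - j).factorial : ℝ) • p j) T = 0 := by
  rw [Finset.sum_apply]
  refine sum_eq_zero fun j _ => ?_
  rw [Pi.smul_apply, smul_eq_mul]
  by_cases hKj : K < j
  · rw [hK j hKj, Pi.zero_apply, mul_zero]
  · rw [(hp j).1 T (by omega), mul_zero]

/-- **Polynomials of `x`-degree `≤ K` live in the layers `V_0, …, V_K` of every slice** (`2K ≤ n + 1`):
for a coefficient vector `h` supported on sets of size `≤ K` and any `t`, there are harmonic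
`q_s` (`q_s = 0` for `s > K`) with `zeta h (U) = (Σ_{s ≤ t} (Wᵀ)^{t−s} q_s)(U)` for all `|U| = t`.
(From the tree's harmonic decomposition `h = Σ_{s,d} (Wᵀ)^d p_{s,d}` and
`zeta ((Wᵀ)^d p)(U) = ff(|U| − s, d) · zeta p (U)`: take `q_s = Σ_d ff(t−s, d)/(t−s)! · p_{s,d}`.)
[cite: MacWilliamsSloane1977, Ch. 21 §6 Thm. 10 with Problem (11) (V_0 ⊕ … ⊕ V_i = column space of the i-sets inclusion matrix A_i; PDF p. 516)] -/
theorem exists_ladderSum_eq_zeta_of_degree_le {K : ℕ} (hK : 2 * K ≤ n + 1) {h : Finset (Fin n) → ℝ}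
    (hh : ∀ T, K < T.card → h T = 0) (t : ℕ) :
    ∃ q : ℕ → Finset (Fin n) → ℝ, (∀ s, IsHarmonic s (q s)) ∧ (∀ s, K < s → q s = 0) ∧
      ∀ U : Finset (Fin n), U.card = t →
        zeta h U = (∑ s ∈ range (t + 1), up^[t - s] (q s)) U := by
  obtain ⟨p, hp, hpz, rfl⟩ := exists_harmonic_decomposition hK hh
  refine ⟨fun s => if K < s then 0 else
      ∑ d ∈ range (K + 1), (ff ((t : ℝ) - s) d / ((t - s).factorial : ℝ)) • p s d, ?_, ?_, ?_⟩
  · intro s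
    dsimp only
    split_ifs with hs
    · exact IsHarmonic.zero s
    · exact IsHarmonic.sum _ fun d _ => (hp s d).smul _
  · intro s hs
    dsimp only
    rw [if_pos hs]
  · intro U hU
    -- both sides equal `Σ_s F s` with the same summand, over different index ranges
    set F : ℕ → ℝ := fun s => ∑ d ∈ range (K + 1), ff ((t : ℝ) - s) d * zeta (p s d) U with hF
    have hFz : ∀ s, K < s → F s = 0 := by
      intro s hs
      refine sum_eq_zero fun d _ => ?_
      rw [hpz s d (by omega), map_zero, Pi.zero_apply, mul_zero]
    have hlhs : zeta (∑ s ∈ range (K + 1), ∑ d ∈ range (K + 1), up^[d] (p s d)) U =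
        ∑ s ∈ range (K + 1), F s := by
      rw [zeta_harmonic_decomposition hp U, hU]
    -- the right-hand summand
    have hG : ∀ s ∈ range (t + 1),
        (up^[t - s] (if K < s then (0 : Finset (Fin n) → ℝ) else
          ∑ d ∈ range (K + 1), (ff ((t : ℝ) - s) d / ((t - s).factorial : ℝ)) • p s d)) U = F s := by
      intro s hs
      have hst : s ≤ t := by have := mem_range.1 hs; omega
      by_cases hKs : K < s
      · rw [if_pos hKs, iterate_up_zero_vec, hFz s hKs]
        rfl
      · rw [if_neg hKs]
        have hhom : IsHomog s (∑ d ∈ range (K + 1),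
            (ff ((t : ℝ) - s) d / ((t - s).factorial : ℝ)) • p s d) :=
          IsHomog.sum _ fun d _ => (hp s d).1.smul _
        rw [ladder_apply_eq_factorial_mul_zeta hst hhom hU, map_sum, Finset.sum_apply, mul_sum]
        refine sum_congr rfl fun d _ => ?_
        rw [map_smul, Pi.smul_apply, smul_eq_mul]
        have hfac : ((t - s).factorial : ℝ) ≠ 0 := Nat.cast_ne_zero.2 (Nat.factorial_ne_zero _)
        field_simp
    rw [hlhs, Finset.sum_apply, sum_congr rfl hG]
    -- extend both index ranges to `range (K + t + 1)`
    have hFt : ∀ s, t < s → F s = 0 := by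
      intro s hs
      refine sum_eq_zero fun d _ => ?_
      rw [zeta_of_isHomog_of_card_lt (hp s d).1 (by rw [hU]; exact hs), mul_zero]
    rw [sum_subset (range_subset_range.2 (by omega : K + 1 ≤ K + t + 1))
        fun s hs hs' => hFz s (by have := mem_range.1 hs; rw [mem_range] at hs'; omega),
      sum_subset (range_subset_range.2 (by omega : t + 1 ≤ K + t + 1))
        fun s hs hs' => hFt s (by have := mem_range.1 hs; rw [mem_range] at hs'; omega)]

/-- **Truncation monotonicity**: shrinking the layers of a ladder sum coefficientwise
(`⟪p'_j, p'_j⟫ ≤ ⟪p_j, p_j⟫`, e.g. `p'_j ∈ {p_j, 0}`) does not increase the norm on the slice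
(`2t ≤ n + 1`).
[cite: MacWilliamsSloane1977, Ch. 21 §6 Thm. 10 (orthogonal eigenspaces V_0, …, V_t; PDF p. 516)] -/
theorem sum_sq_ladderSum_le_of_ip_le {t : ℕ} (ht : 2 * t ≤ n + 1) (p p' : ℕ → Finset (Fin n) → ℝ)
    (hp : ∀ j, IsHarmonic j (p j)) (hp' : ∀ j, IsHarmonic j (p' j))
    (hle : ∀ j, j ≤ t → ip (p' j) (p' j) ≤ ip (p j) (p j)) :
    ∑ U ∈ univ.powersetCard t, (∑ j ∈ range (t + 1), up^[t - j] (p' j)) U ^ 2 ≤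
      ∑ U ∈ univ.powersetCard t, (∑ j ∈ range (t + 1), up^[t - j] (p j)) U ^ 2 := by
  rw [sum_sq_ladderSum p' hp', sum_sq_ladderSum p hp]
  refine sum_le_sum fun j hj => ?_
  have hjt : j ≤ t := by have := mem_range.1 hj; omega
  exact mul_le_mul_of_nonneg_left (hle j hjt) (ladderProd_range_nonneg hjt ht)

/-- A truncated family of harmonic layers is again a family of harmonic layers. [folklore] -/
private theorem isHarmonic_ite {K : ℕ} (p : ℕ → Finset (Fin n) → ℝ) (hp : ∀ j, IsHarmonic j (p j))
    (j : ℕ) : IsHarmonic j (if K < j then p j else 0) := by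
  split_ifs
  · exact hp j
  · exact IsHarmonic.zero j

/-- A truncated family of harmonic layers is again a family of harmonic layers. [folklore] -/
private theorem isHarmonic_ite' {K : ℕ} (p : ℕ → Finset (Fin n) → ℝ) (hp : ∀ j, IsHarmonic j (p j))
    (j : ℕ) : IsHarmonic j (if K < j then 0 else p j) := by
  split_ifs
  · exact IsHarmonic.zero j
  · exact hp j

/-- **Low part + high part**: `Σ_j (Wᵀ)^{t−j} p_j = Σ_{j ≤ K} (Wᵀ)^{t−j} p_j + Σ_{j > K} (Wᵀ)^{t−j} p_j`,
written with truncated families.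
[cite: MacWilliamsSloane1977, Ch. 21 §6 Thm. 10 (R^X = V_0 ⊕ … ⊕ V_t; PDF p. 516)] -/
theorem ladderSum_eq_low_add_high {t : ℕ} (K : ℕ) (p : ℕ → Finset (Fin n) → ℝ) :
    ∑ j ∈ range (t + 1), up^[t - j] (p j) =
      ∑ j ∈ range (t + 1), up^[t - j] (if K < j then 0 else p j) +
        ∑ j ∈ range (t + 1), up^[t - j] (if K < j then p j else 0) := by
  rw [← sum_add_distrib]
  refine sum_congr rfl fun j _ => ?_
  split_ifs
  · rw [iterate_up_zero_vec, zero_add]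
  · rw [iterate_up_zero_vec, add_zero]

/-- **The low part is a polynomial of `x`-degree `≤ K` on the slice**: for `|U| = t`,
`(Σ_{j ≤ t} (Wᵀ)^{t−j} [j ≤ K] p_j)(U) = zeta c (U)` with `c = Σ_j (t−j)!·[j ≤ K] p_j` supported on sets
of size `≤ K` — the input shape `f = Σ_{|A| ≤ K} c_A 𝟙[A ⊆ U]` of degree-truncation arguments.
[cite: MacWilliamsSloane1977, Ch. 21 §6 Thm. 10 with Problem (11) (V_0 ⊕ … ⊕ V_i = column space of A_i; PDF p. 516)] -/
theorem lowPart_apply_eq_zeta {t : ℕ} (K : ℕ) (p : ℕ → Finset (Fin n) → ℝ)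
    (hp : ∀ j, IsHarmonic j (p j)) {U : Finset (Fin n)} (hU : U.card = t) :
    (∑ j ∈ range (t + 1), up^[t - j] (if K < j then 0 else p j)) U =
        zeta (∑ j ∈ range (t + 1), ((t - j).factorial : ℝ) • (if K < j then 0 else p j)) U ∧
      ∀ T : Finset (Fin n), K < T.card →
        (∑ j ∈ range (t + 1), ((t - j).factorial : ℝ) • (if K < j then 0 else p j)) T = 0 :=
  ⟨ladderSum_apply_eq_zeta _ (isHarmonic_ite' p hp) hU,
    fun _ hT => ladderCoeff_eq_zero_of_lt_card _ (isHarmonic_ite' p hp)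
      (fun j hj => by rw [if_pos hj]) hT⟩

/-- **The high part has zero mean and no larger norm**: `Σ_{|U|=t} f_{>K}(U) = 0` and
`Σ_{|U|=t} f_{>K}(U)² ≤ Σ_{|U|=t} f(U)²` (`2t ≤ n + 1`), where `f_{>K} = Σ_{j > K} (Wᵀ)^{t−j} p_j`.
[cite: BrouwerHaemers2012, Prop. 4.3.2 proof (Σ_{i>1} α_i² ≤ (χ_S, χ_S); PDF p. 83)] -/
theorem highPart_sum_eq_zero_and_sum_sq_le {t : ℕ} (ht : 2 * t ≤ n + 1) (K : ℕ)
    (p : ℕ → Finset (Fin n) → ℝ) (hp : ∀ j, IsHarmonic j (p j)) :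
    ∑ U ∈ univ.powersetCard t, (∑ j ∈ range (t + 1), up^[t - j] (if K < j then p j else 0)) U = 0 ∧
      ∑ U ∈ univ.powersetCard t, (∑ j ∈ range (t + 1), up^[t - j] (if K < j then p j else 0)) U ^ 2 ≤
        ∑ U ∈ univ.powersetCard t, (∑ j ∈ range (t + 1), up^[t - j] (p j)) U ^ 2 := by
  refine ⟨sum_powersetCard_ladderSum_eq_zero _ (isHarmonic_ite p hp) (by simp), ?_⟩
  refine sum_sq_ladderSum_le_of_ip_le ht p _ hp (isHarmonic_ite p hp) fun j _ => ?_
  split_ifs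
  · exact le_rfl
  · rw [ip_zero_left]; exact ip_self_nonneg _

/-- **High-part Gram bound**: for `A` with class-function Gram kernel `κ` on `t`-sets (`2t ≤ n + 1`)
and `Λ ≥ 0` bounding `kernelEigen n t j κ` for the DEEP layers `K < j ≤ t` only,
`‖Aᵀ f_{>K}‖² = Σ_b (Σ_{|U|=t} f_{>K}(U) A(U,b))² ≤ Λ · Σ_{|U|=t} f(U)²` — the "high part" of a
degree-truncation argument is controlled by the eigenvalues beyond `K` and the FULL norm of `f`.
[cite: BrouwerHaemers2012, Prop. 4.3.2 (expander mixing lemma, Alon–Chung; PDF p. 83)] -/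
theorem sum_sq_gram_highPart_le {β : Type*} [Fintype β] {t : ℕ} (ht : 2 * t ≤ n + 1) (K : ℕ)
    (A : Finset (Fin n) → β → ℝ) (κ : ℕ → ℝ)
    (hA : ∀ U ∈ univ.powersetCard t, ∀ U' ∈ univ.powersetCard t,
      ∑ b, A U b * A U' b = κ (U ∩ U').card)
    (p : ℕ → Finset (Fin n) → ℝ) (hp : ∀ j, IsHarmonic j (p j)) {Λ : ℝ} (hΛ0 : 0 ≤ Λ)
    (hΛ : ∀ j, K < j → j ≤ t → kernelEigen n t j κ ≤ Λ) :
    ∑ b, (∑ U ∈ univ.powersetCard t,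
        (∑ j ∈ range (t + 1), up^[t - j] (if K < j then p j else 0)) U * A U b) ^ 2 ≤
      Λ * ∑ U ∈ univ.powersetCard t, (∑ j ∈ range (t + 1), up^[t - j] (p j)) U ^ 2 := by
  rw [sum_sq_gram_ladderDecomposition A κ hA _ (isHarmonic_ite p hp), sum_sq_ladderSum p hp, mul_sum]
  refine sum_le_sum fun j hj => ?_
  have hjt : j ≤ t := by have := mem_range.1 hj; omega
  have hnn : 0 ≤ (∏ i ∈ range (t - j), ladder n j i) * ip (p j) (p j) :=
    mul_nonneg (ladderProd_range_nonneg hjt ht) (ip_self_nonneg _)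
  by_cases hKj : K < j
  · simp only [if_pos hKj]
    exact mul_le_mul_of_nonneg_right (hΛ j hKj hjt) hnn
  · simp only [if_neg hKj, ip_zero_left, mul_zero]
    exact mul_nonneg hΛ0 hnn

/-! ### §9 Dipole products `Π_i (x_{a_i} − x_{b_i})`: explicit harmonic vectors (the Frankl–Graham /
Filmus functions `χ_{A,B}`) (appended) -/

/-- Multiplication of a multilinear coefficient vector by the variable `x_c`:
`(mulVar c v)(T) = [c ∈ T] · v(T ∖ {c})` (for `v` not involving `x_c` this is the coefficient vector
of `x_c · P_v`).
[cite: Filmus2016, Def. 2.1–2.2 (multilinear polynomials; χ_{A,B} = Π (x_{a_i} − x_{b_i}); arXiv p. 4)] -/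
def mulVar (c : Fin n) (v : Finset (Fin n) → ℝ) : Finset (Fin n) → ℝ :=
  fun T => if c ∈ T then v (T.erase c) else 0

/-- Unfolding of `mulVar`. [cite: Filmus2016, Def. 2.1–2.2 (arXiv p. 4)] -/
theorem mulVar_apply (c : Fin n) (v : Finset (Fin n) → ℝ) (T : Finset (Fin n)) :
    mulVar c v T = if c ∈ T then v (T.erase c) else 0 := rfl

/-- `v` does not involve the variable `x_c`: `v(T) = 0` whenever `c ∈ T`.
[cite: Filmus2016, Def. 2.2 ("two disjoint sequences A, B"; arXiv p. 4)] -/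
def Avoids (c : Fin n) (v : Finset (Fin n) → ℝ) : Prop := ∀ T, c ∈ T → v T = 0

/-- Multiplying by another variable preserves avoidance. [cite: Filmus2016, Def. 2.2 (arXiv p. 4)] -/
theorem avoids_mulVar_of_ne {c c' : Fin n} {v : Finset (Fin n) → ℝ} (h : Avoids c v) (hcc' : c ≠ c') :
    Avoids c (mulVar c' v) := by
  intro T hT
  rw [mulVar_apply]
  split_ifs with h'
  · exact h _ (mem_erase.2 ⟨hcc', hT⟩)
  · rfl

/-- Avoidance is preserved by differences. [cite: Filmus2016, Def. 2.2 (arXiv p. 4)] -/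
theorem avoids_sub {c : Fin n} {u v : Finset (Fin n) → ℝ} (hu : Avoids c u) (hv : Avoids c v) :
    Avoids c (u - v) := fun T hT => by rw [Pi.sub_apply, hu T hT, hv T hT, sub_zero]

/-- `mulVar c` raises the degree by one. [cite: Filmus2016, Def. 2.1 (arXiv p. 4)] -/
theorem isHomog_mulVar {k : ℕ} {c : Fin n} {v : Finset (Fin n) → ℝ} (hv : IsHomog k v) :
    IsHomog (k + 1) (mulVar c v) := by
  intro T hT
  rw [mulVar_apply]
  split_ifs with hc
  · have h1 := card_erase_of_mem hc
    have h2 : 0 < T.card := card_pos.2 ⟨c, hc⟩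
    exact hv _ (by omega)
  · rfl

/-- **Leibniz rule for the lowering operator**: for `v` not involving `x_c`,
`W (x_c · v) = x_c · (W v) + v` — the coefficient form of `Σ_i ∂_i (x_c P) = P + x_c Σ_i ∂_i P`.
[cite: Filmus2016, Lemma 2.3 proof (Σ_i ∂χ_{A,B}/∂x_i = Σ_j (1 − 1) χ_{A,B}/(x_{a_j} − x_{b_j}) = 0; arXiv p. 5)] -/
theorem down_mulVar {c : Fin n} {v : Finset (Fin n) → ℝ} (hv : Avoids c v) :
    down (mulVar c v) = mulVar c (down v) + v := by
  ext T
  simp only [down_apply, Pi.add_apply, mulVar_apply]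
  by_cases hc : c ∈ T
  · rw [if_pos hc, hv T hc, add_zero, compl_erase, sum_insert (by simpa using hc), insert_erase hc,
      hv T hc, zero_add]
    refine sum_congr rfl fun x hx => ?_
    have hxc : x ≠ c := fun h => (mem_compl.1 hx) (h ▸ hc)
    rw [if_pos (mem_insert_of_mem hc), erase_insert_of_ne hxc]
  · rw [if_neg hc, zero_add, sum_eq_single_of_mem c (mem_compl.2 hc) fun x _ hxc => by
      rw [if_neg (by rw [mem_insert, not_or]; exact ⟨fun h => hxc h.symm, hc⟩)]]
    rw [if_pos (mem_insert_self c T), erase_insert hc]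

/-- **Cube evaluation of `x_c · v`**: for `v` not involving `x_c`, `zeta (mulVar c v)(U) = [c ∈ U] · zeta v (U)`.
[cite: Filmus2016, Def. 2.1–2.2 (arXiv p. 4)] -/
theorem zeta_mulVar {c : Fin n} {v : Finset (Fin n) → ℝ} (hv : Avoids c v) (U : Finset (Fin n)) :
    zeta (mulVar c v) U = (if c ∈ U then 1 else 0) * zeta v U := by
  simp only [zeta_apply, mulVar_apply]
  by_cases hc : c ∈ U
  · rw [if_pos hc, one_mul, ← insert_erase hc, sum_powerset_insert (notMem_erase c U),
      sum_powerset_insert (notMem_erase c U)]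
    have h1 : ∑ T ∈ (U.erase c).powerset, (if c ∈ T then v (T.erase c) else 0) = 0 :=
      sum_eq_zero fun T hT => if_neg fun h => notMem_erase c U (mem_powerset.1 hT h)
    have h2 : ∑ T ∈ (U.erase c).powerset, v (insert c T) = 0 :=
      sum_eq_zero fun T _ => hv _ (mem_insert_self c T)
    rw [h1, h2, zero_add, add_zero]
    refine sum_congr rfl fun T hT => ?_
    have hcT : c ∉ T := fun h => notMem_erase c U (mem_powerset.1 hT h)
    rw [if_pos (mem_insert_self c T), erase_insert hcT]
  · rw [if_neg hc, zero_mul]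
    exact sum_eq_zero fun T hT => if_neg fun h => hc (mem_powerset.1 hT h)

/-- `⟪x_c u, x_c v⟫ = ⟪u, v⟫` for `u` not involving `x_c`. [cite: Filmus2016, §3 (norms of the basis elements; arXiv p. 6)] -/
theorem ip_mulVar_mulVar_same {c : Fin n} {u : Finset (Fin n) → ℝ} (hu : Avoids c u)
    (v : Finset (Fin n) → ℝ) : ip (mulVar c u) (mulVar c v) = ip u v := by
  unfold ip
  simp only [mulVar_apply]
  rw [← sum_filter_add_sum_filter_not univ (fun T : Finset (Fin n) => c ∈ T),
    ← sum_filter_add_sum_filter_not univ (fun T : Finset (Fin n) => c ∈ T) (fun T => u T * v T),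
    sum_filter_mem_eq_sum_filter_not_mem c]
  have h1 : ∑ T ∈ univ.filter (fun T : Finset (Fin n) => c ∈ T), u T * v T = 0 :=
    sum_eq_zero fun T hT => by rw [hu T (mem_filter.1 hT).2, zero_mul]
  have h2 : ∑ T ∈ univ.filter (fun T : Finset (Fin n) => ¬ c ∈ T),
      (if c ∈ T then u (T.erase c) else 0) * (if c ∈ T then v (T.erase c) else 0) = 0 :=
    sum_eq_zero fun T hT => by rw [if_neg (mem_filter.1 hT).2, zero_mul]
  rw [h1, h2, zero_add, add_zero]
  refine sum_congr rfl fun T hT => ?_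
  have hcT : c ∉ T := (mem_filter.1 hT).2
  rw [if_pos (mem_insert_self c T), if_pos (mem_insert_self c T), erase_insert hcT]

/-- `⟪x_c u, x_{c'} v⟫ = 0` for `c ≠ c'` when `u` does not involve `x_{c'}`.
[cite: Filmus2016, §3 (norms of the basis elements; arXiv p. 6)] -/
theorem ip_mulVar_mulVar_of_ne {c c' : Fin n} {u v : Finset (Fin n) → ℝ} (hcc' : c ≠ c')
    (hu : Avoids c' u) : ip (mulVar c u) (mulVar c' v) = 0 := by
  unfold ip
  refine sum_eq_zero fun T _ => ?_
  simp only [mulVar_apply]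
  split_ifs with hc hc'
  · rw [hu _ (mem_erase.2 ⟨fun h => hcc' h.symm, hc'⟩), zero_mul]
  · rw [mul_zero]
  · rw [zero_mul]
  · rw [zero_mul]

/-- **The dipole product** `χ_{a,b} = Π_{i<k} (x_{a_i} − x_{b_i})` as a coefficient vector, by
recursion on the number of dipoles: `χ = δ_∅` for `k = 0` and
`χ_{a,b} = x_{a_0} · χ_{a',b'} − x_{b_0} · χ_{a',b'}` (`a', b'` the tails).
[cite: Filmus2016, Def. 2.2 (χ_{A,B} = Π_{i=1}^d (x_{a_i} − x_{b_i}); arXiv p. 4)] -/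
def dipoleVec : (k : ℕ) → (Fin k → Fin n) → (Fin k → Fin n) → (Finset (Fin n) → ℝ)
  | 0, _, _ => delta ∅
  | k + 1, a, b =>
      mulVar (a 0) (dipoleVec k (Fin.tail a) (Fin.tail b)) -
        mulVar (b 0) (dipoleVec k (Fin.tail a) (Fin.tail b))

/-- The dipole product does not involve variables outside its `2k` points.
[cite: Filmus2016, Def. 2.2 (arXiv p. 4)] -/
theorem avoids_dipoleVec : ∀ (k : ℕ) (a b : Fin k → Fin n) (c : Fin n),
    (∀ i, a i ≠ c) → (∀ i, b i ≠ c) → Avoids c (dipoleVec k a b)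
  | 0, _, _, c, _, _ => by
    intro T hT
    simp only [dipoleVec, delta]
    rw [if_neg]
    rintro rfl
    simp at hT
  | k + 1, a, b, c, ha, hb => by
    have ih := avoids_dipoleVec k (Fin.tail a) (Fin.tail b) c (fun i => ha i.succ) (fun i => hb i.succ)
    exact avoids_sub (avoids_mulVar_of_ne ih (ha 0).symm) (avoids_mulVar_of_ne ih (hb 0).symm)

/-- `L_t` is closed under differences. [cite: LeePrakashDewolfYuen2016, App. B §B.1 (the spaces L_t; arXiv text chunk 19)] -/
theorem isHomog_sub {t : ℕ} {u v : Finset (Fin n) → ℝ} (hu : IsHomog t u) (hv : IsHomog t v) :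
    IsHomog t (u - v) := fun S hS => by rw [Pi.sub_apply, hu S hS, hv S hS, sub_zero]

/-- `⟪u − u', v⟫ = ⟪u, v⟫ − ⟪u', v⟫`. [cite: LeePrakashDewolfYuen2016, App. B §B.3 (inner product; arXiv text chunk 20)] -/
theorem ip_sub_left (u u' v : Finset (Fin n) → ℝ) : ip (u - u') v = ip u v - ip u' v := by
  unfold ip; rw [← sum_sub_distrib]; exact sum_congr rfl fun S _ => by rw [Pi.sub_apply]; ring

/-- `⟪u, v − v'⟫ = ⟪u, v⟫ − ⟪u, v'⟫`. [cite: LeePrakashDewolfYuen2016, App. B §B.3 (inner product; arXiv text chunk 20)] -/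
theorem ip_sub_right (u v v' : Finset (Fin n) → ℝ) : ip u (v - v') = ip u v - ip u v' := by
  rw [ip_comm, ip_sub_left, ip_comm v, ip_comm v']

/-- The dipole product of `k` dipoles is homogeneous of degree `k`.
[cite: Filmus2016, Lemma 2.3 proof ("all functions in X_d are multilinear polynomials of pure degree d"; arXiv p. 5)] -/
theorem isHomog_dipoleVec : ∀ (k : ℕ) (a b : Fin k → Fin n), IsHomog k (dipoleVec k a b)
  | 0, _, _ => by
    have h := isHomog_delta (∅ : Finset (Fin n))
    rw [card_empty] at h
    simpa only [dipoleVec] using h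
  | k + 1, a, b => by
    simp only [dipoleVec]
    exact isHomog_sub (isHomog_mulVar (isHomog_dipoleVec k _ _)) (isHomog_mulVar (isHomog_dipoleVec k _ _))


/-- `x_c · 0 = 0`. [cite: Filmus2016, Def. 2.1 (arXiv p. 4)] -/
theorem mulVar_zero (c : Fin n) : mulVar c (0 : Finset (Fin n) → ℝ) = 0 := by
  ext T; simp [mulVar_apply]

/-- **Dipole products are harmonic** (Frankl–Graham; Filmus Lemma 2.3): for injective, disjoint
sequences `a, b : Fin k → Fin n`, `W χ_{a,b} = 0` — by the Leibniz rule,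
`W(x_{a₀} χ' − x_{b₀} χ') = (x_{a₀} − x_{b₀}) W χ' + χ' − χ'`.
[cite: Filmus2016, Lemma 2.3 (the χ_{φ(B),B} are harmonic: Σ_i ∂χ_{A,B}/∂x_i = 0; arXiv p. 5)] -/
theorem down_dipoleVec : ∀ (k : ℕ) (a b : Fin k → Fin n), Function.Injective a → Function.Injective b →
    (∀ i j, a i ≠ b j) → down (dipoleVec k a b) = 0
  | 0, _, _, _, _, _ => by
    ext T
    simp only [dipoleVec, down_apply, delta, Pi.zero_apply]
    exact sum_eq_zero fun x _ => if_neg (insert_ne_empty x T)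
  | k + 1, a, b, ha, hb, hab => by
    have ha' : Function.Injective (Fin.tail a) := fun i j h => Fin.succ_injective _ (ha h)
    have hb' : Function.Injective (Fin.tail b) := fun i j h => Fin.succ_injective _ (hb h)
    have hab' : ∀ i j, Fin.tail a i ≠ Fin.tail b j := fun i j => hab i.succ j.succ
    have ih := down_dipoleVec k _ _ ha' hb' hab'
    have hA : Avoids (a 0) (dipoleVec k (Fin.tail a) (Fin.tail b)) :=
      avoids_dipoleVec k _ _ (a 0) (fun i h => Fin.succ_ne_zero i (ha h)) (fun i h => hab 0 i.succ h.symm)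
    have hB : Avoids (b 0) (dipoleVec k (Fin.tail a) (Fin.tail b)) :=
      avoids_dipoleVec k _ _ (b 0) (fun i h => hab i.succ 0 h) (fun i h => Fin.succ_ne_zero i (hb h))
    simp only [dipoleVec]
    rw [map_sub, down_mulVar hA, down_mulVar hB, ih, mulVar_zero, mulVar_zero, sub_self]

/-- **Dipole products are harmonic of degree `k`** (`χ_{a,b} ∈ Ker W_k`, the tree's `IsHarmonic`).
[cite: Filmus2016, Lemma 2.3 (arXiv p. 5)] -/
theorem isHarmonic_dipoleVec {k : ℕ} {a b : Fin k → Fin n} (ha : Function.Injective a)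
    (hb : Function.Injective b) (hab : ∀ i j, a i ≠ b j) : IsHarmonic k (dipoleVec k a b) :=
  ⟨isHomog_dipoleVec k a b, down_dipoleVec k a b ha hb hab⟩

/-- **Cube evaluation of the dipole product**: `zeta χ_{a,b} (U) = Π_{i<k} (𝟙[a_i ∈ U] − 𝟙[b_i ∈ U])`
— the function on subsets (in particular on every slice) used as the `k`-dipole test vector.
[cite: Filmus2016, Def. 2.2 (χ_{A,B} = Π (x_{a_i} − x_{b_i}); arXiv p. 4)] -/
theorem zeta_dipoleVec : ∀ (k : ℕ) (a b : Fin k → Fin n), Function.Injective a → Function.Injective b →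
    (∀ i j, a i ≠ b j) → ∀ U : Finset (Fin n),
      zeta (dipoleVec k a b) U = ∏ i, ((if a i ∈ U then (1 : ℝ) else 0) - (if b i ∈ U then (1 : ℝ) else 0))
  | 0, _, _, _, _, _, U => by
    rw [Fin.prod_univ_zero]
    simp only [dipoleVec, zeta_delta, empty_subset, if_true]
  | k + 1, a, b, ha, hb, hab, U => by
    have ha' : Function.Injective (Fin.tail a) := fun i j h => Fin.succ_injective _ (ha h)
    have hb' : Function.Injective (Fin.tail b) := fun i j h => Fin.succ_injective _ (hb h)
    have hab' : ∀ i j, Fin.tail a i ≠ Fin.tail b j := fun i j => hab i.succ j.succ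
    have ih := zeta_dipoleVec k _ _ ha' hb' hab' U
    have hA : Avoids (a 0) (dipoleVec k (Fin.tail a) (Fin.tail b)) :=
      avoids_dipoleVec k _ _ (a 0) (fun i h => Fin.succ_ne_zero i (ha h)) (fun i h => hab 0 i.succ h.symm)
    have hB : Avoids (b 0) (dipoleVec k (Fin.tail a) (Fin.tail b)) :=
      avoids_dipoleVec k _ _ (b 0) (fun i h => hab i.succ 0 h) (fun i h => Fin.succ_ne_zero i (hb h))
    simp only [dipoleVec]
    rw [map_sub, Pi.sub_apply, zeta_mulVar hA, zeta_mulVar hB, ih, Fin.prod_univ_succ, ← sub_mul]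
    rfl

/-- **Norm of the dipole product**: `⟪χ_{a,b}, χ_{a,b}⟫ = 2^k` (its `2^k` transversals carry
coefficients `±1`).
[cite: Filmus2016, §3 (norms of the basis elements; arXiv p. 6)] -/
theorem ip_dipoleVec_self : ∀ (k : ℕ) (a b : Fin k → Fin n), Function.Injective a → Function.Injective b →
    (∀ i j, a i ≠ b j) → ip (dipoleVec k a b) (dipoleVec k a b) = (2 : ℝ) ^ k
  | 0, _, _, _, _, _ => by
    simp only [dipoleVec, ip_delta_right, delta, if_true, pow_zero]
  | k + 1, a, b, ha, hb, hab => by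
    have ha' : Function.Injective (Fin.tail a) := fun i j h => Fin.succ_injective _ (ha h)
    have hb' : Function.Injective (Fin.tail b) := fun i j h => Fin.succ_injective _ (hb h)
    have hab' : ∀ i j, Fin.tail a i ≠ Fin.tail b j := fun i j => hab i.succ j.succ
    have ih := ip_dipoleVec_self k _ _ ha' hb' hab'
    have hA : Avoids (a 0) (dipoleVec k (Fin.tail a) (Fin.tail b)) :=
      avoids_dipoleVec k _ _ (a 0) (fun i h => Fin.succ_ne_zero i (ha h)) (fun i h => hab 0 i.succ h.symm)
    have hB : Avoids (b 0) (dipoleVec k (Fin.tail a) (Fin.tail b)) :=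
      avoids_dipoleVec k _ _ (b 0) (fun i h => hab i.succ 0 h) (fun i h => Fin.succ_ne_zero i (hb h))
    simp only [dipoleVec]
    rw [ip_sub_left, ip_sub_right, ip_sub_right, ip_mulVar_mulVar_same hA _, ip_mulVar_mulVar_same hB _,
      ip_mulVar_mulVar_of_ne (hab 0 0) hB, ip_mulVar_mulVar_of_ne (Ne.symm (hab 0 0)) hA, ih, pow_succ]
    ring

/-- The ladder norm factor is POSITIVE below the middle: `j ≤ t`, `2t ≤ n` ⇒ `Π_{i<t−j} λ_j(i) > 0`.
[cite: LeePrakashDewolfYuen2016, App. B Thm. B.1 / Lemma B.8 (Johnson-scheme spectrum; arXiv text chunks 19, 21)] -/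
theorem ladderProd_range_pos {t j : ℕ} (hjt : j ≤ t) (ht : 2 * t ≤ n) :
    0 < ∏ i ∈ range (t - j), ladder n j i := by
  refine prod_pos fun i hi => ?_
  have hi' := mem_range.1 hi
  unfold ladder
  have h1 : (0 : ℝ) < (i : ℝ) + 1 := by positivity
  have h2 : (0 : ℝ) < (n : ℝ) - 2 * j - i := by
    have hle : 2 * j + i + 1 ≤ n := by omega
    have hle' : ((2 * j + i + 1 : ℕ) : ℝ) ≤ (n : ℝ) := by exact_mod_cast hle
    push_cast at hle'
    linarith
  exact mul_pos h1 h2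

/-- **The `k`-dipole test vector is a nonzero element of the layer `V_k` of every slice**
`k ≤ t ≤ n/2`: `Σ_{|U| = t} ((Wᵀ)^{t−k} χ_{a,b})(U)² = (Π_{i<t−k} λ_k(i)) · 2^k > 0`.
[cite: Filmus2016, Lemma 2.3 with §3 (χ_{A,B} harmonic of pure degree d, nonzero; arXiv pp. 5–6)] -/
theorem sum_sq_ladder_dipoleVec {k t : ℕ} (hkt : k ≤ t) {a b : Fin k → Fin n}
    (ha : Function.Injective a) (hb : Function.Injective b) (hab : ∀ i j, a i ≠ b j) :
    ∑ U ∈ univ.powersetCard t, (up^[t - k] (dipoleVec k a b)) U ^ 2 =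
      (∏ i ∈ range (t - k), ladder n k i) * (2 : ℝ) ^ k := by
  have hh := isHarmonic_dipoleVec ha hb hab
  have hv : IsHomog t (up^[t - k] (dipoleVec k a b)) := by
    have h := isHomog_iterate_up hh.1 (t - k)
    rwa [Nat.add_sub_cancel' hkt] at h
  rw [← ip_dipoleVec_self k a b ha hb hab, ← ip_iterate_up_of_isHarmonic hh,
    ← sum_powersetCard_mul_of_isHomog _ hv]
  exact sum_congr rfl fun U _ => sq _

/-- Positivity form of the previous statement (`2t ≤ n`). [cite: Filmus2016, Lemma 2.3 with §3 (arXiv pp. 5–6)] -/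
theorem sum_sq_ladder_dipoleVec_pos {k t : ℕ} (hkt : k ≤ t) (ht : 2 * t ≤ n) {a b : Fin k → Fin n}
    (ha : Function.Injective a) (hb : Function.Injective b) (hab : ∀ i j, a i ≠ b j) :
    0 < ∑ U ∈ univ.powersetCard t, (up^[t - k] (dipoleVec k a b)) U ^ 2 := by
  rw [sum_sq_ladder_dipoleVec hkt ha hb hab]
  exact mul_pos (ladderProd_range_pos hkt ht) (pow_pos two_pos k)

/-- **Eigenvalues read off the dipole test vector**: for any kernel `κ(|U ∩ U'|)` on `t`-sets and
`k ≤ t`, `Σ_{U,U'} φ(U) κ(|U ∩ U'|) φ(U') = kernelEigen n t k κ · (Π_{i<t−k} λ_k(i)) · 2^k` with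
`φ = (Wᵀ)^{t−k} χ_{a,b}`; since the norm factor is positive for `2t ≤ n`, `kernelEigen n t k κ` is the
Rayleigh quotient of ONE explicit test vector (the "dipole route" to the layer eigenvalues).
[cite: MacWilliamsSloane1977, Ch. 21 §6 Thm. 10 (eigenvalue on V_k; PDF p. 516); Filmus2016, Lemma 2.3 (arXiv p. 5)] -/
theorem sum_kernel_dipoleVec {k t : ℕ} (hkt : k ≤ t) {a b : Fin k → Fin n}
    (ha : Function.Injective a) (hb : Function.Injective b) (hab : ∀ i j, a i ≠ b j) (κ : ℕ → ℝ) :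
    ∑ U ∈ univ.powersetCard t, ∑ U' ∈ univ.powersetCard t,
        (up^[t - k] (dipoleVec k a b)) U * (κ (U ∩ U').card * (up^[t - k] (dipoleVec k a b)) U') =
      kernelEigen n t k κ * ((∏ i ∈ range (t - k), ladder n k i) * (2 : ℝ) ^ k) := by
  rw [sum_kernel_ladder_ladder_same hkt (isHarmonic_dipoleVec ha hb hab) _ κ, ip_dipoleVec_self k a b ha hb hab]

/-! ### §7 (continued) The two-sided zero-rectangle bound: Haemers' inequality with both density
corrections, for row- AND column-regular `A` (appended) -/

/-- **Haemers' inequality for a flag-free rectangle, two-sided form.** As in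
`card_mul_card_mul_sq_le_of_sum_eq_zero`, and additionally with constant ROW sums
`Σ_b A(U,b) = d_R` on the `t`-sets: if `Σ_{U ∈ X} Σ_{b ∈ Y} A(U,b) = 0` then
`|β| · |X| · |Y| · d_C² ≤ Λ · C(n,t) · (C(n,t) − |X|) · (|β| − |Y|)`, i.e. with densities
`μ = |X|/C(n,t)`, `ν = |Y|/|β|` and `λ₀ = d_R d_C` (note `C(n,t)·d_R = |β|·d_C`):
**`μ ν ≤ (1 − μ)(1 − ν) · Λ/λ₀`** — the printed form of Haemers' bound for a substructure without flags
of a `1`-design (`b'k · v'r ≤ θ₂² (v − v')(b − b')` with `θ₂² ≤ Λ`), here for any real biregular `A`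
whose Gram kernel on the `t`-sets lies in the Bose–Mesner algebra of `J(n,t)`. Proof: project BOTH
indicators off the constants (`C(n,t)·𝟙_X − |X|·𝟙` and `|β|·𝟙_Y − |Y|·𝟙`; row-regularity makes `Aᵀ h`
orthogonal to `𝟙_β`) and apply Cauchy–Schwarz once — the eigenvector-expansion proof of the expander
mixing lemma rather than the book's interlacing.
[cite: BrouwerHaemers2012, Thm. 4.9.1 (case m' = 0; PDF p. 93) and Prop. 4.3.2 (the bound with both factors √((1 − s/n)(1 − t/n)); PDF p. 83)] -/
theorem card_mul_card_mul_sq_le_of_sum_eq_zero_of_biregular {β : Type*} [Fintype β] {t : ℕ}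
    (ht : 2 * t ≤ n + 1) (A : Finset (Fin n) → β → ℝ) (κ : ℕ → ℝ)
    (hA : ∀ U ∈ univ.powersetCard t, ∀ U' ∈ univ.powersetCard t,
      ∑ b, A U b * A U' b = κ (U ∩ U').card)
    {dC dR : ℝ} (hcol : ∀ b, ∑ U ∈ univ.powersetCard t, A U b = dC)
    (hrow : ∀ U ∈ univ.powersetCard t, ∑ b, A U b = dR)
    {Λ : ℝ} (hΛ0 : 0 ≤ Λ) (hΛ : ∀ j, 1 ≤ j → j ≤ t → kernelEigen n t j κ ≤ Λ)
    (X : Finset (Finset (Fin n))) (hX : X ⊆ univ.powersetCard t) (Y : Finset β)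
    (hXY : ∑ U ∈ X, ∑ b ∈ Y, A U b = 0) :
    (Fintype.card β : ℝ) * X.card * Y.card * dC ^ 2 ≤
      Λ * (n.choose t : ℝ) * ((n.choose t : ℝ) - X.card) * ((Fintype.card β : ℝ) - Y.card) := by
  classical
  set P : Finset (Finset (Fin n)) := univ.powersetCard t with hP
  have hPcard : (P.card : ℝ) = (n.choose t : ℝ) := by
    rw [hP, card_powersetCard, card_univ, Fintype.card_fin]
  set N : ℝ := (n.choose t : ℝ) with hN
  set Bc : ℝ := (Fintype.card β : ℝ) with hBc
  have hXN : (X.card : ℝ) ≤ N := by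
    rw [← hPcard]; exact_mod_cast card_le_card hX
  have hYB : (Y.card : ℝ) ≤ Bc := by
    rw [hBc]; exact_mod_cast card_le_univ Y
  -- the test vector on the `t`-sets, as in the one-sided proof
  set h : Finset (Fin n) → ℝ :=
    fun U => if U.card = t then N * (if U ∈ X then 1 else 0) - X.card else 0 with hh
  have hhom : IsHomog t h := fun U hU => by simp only [hh, hU, if_false]
  have hval : ∀ U ∈ P, h U = N * (if U ∈ X then 1 else 0) - X.card := fun U hU => by
    simp only [hh, mem_powersetCard_univ.1 hU, if_true]
  have hind : ∀ (F : Finset (Fin n) → ℝ),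
      ∑ U ∈ P, (if U ∈ X then 1 else 0) * F U = ∑ U ∈ X, F U := by
    intro F
    rw [← sum_subset hX fun U _ hUX => by rw [if_neg hUX, zero_mul]]
    exact sum_congr rfl fun U hU => by rw [if_pos hU, one_mul]
  have hsum0 : ∑ U ∈ P, h U = 0 := by
    rw [sum_congr rfl hval, sum_sub_distrib, ← mul_sum, sum_const, nsmul_eq_mul, hPcard]
    have h1 : ∑ U ∈ P, (if U ∈ X then (1 : ℝ) else 0) = X.card := by
      have := hind fun _ => 1
      simp only [mul_one, sum_const, nsmul_eq_mul] at this
      rw [this]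
    rw [h1]
    ring
  have hnorm : ∑ U ∈ P, h U ^ 2 = X.card * (N - X.card) * N := by
    rw [sum_congr rfl fun U hU => by rw [hval U hU], ← sum_sdiff hX]
    have hin : ∑ U ∈ X, (N * (if U ∈ X then 1 else 0) - X.card) ^ 2 = X.card * (N - X.card) ^ 2 := by
      rw [sum_congr rfl fun U hU => by rw [if_pos hU, mul_one], sum_const, nsmul_eq_mul]
    have hout : ∑ U ∈ P \ X, (N * (if U ∈ X then 1 else 0) - X.card) ^ 2 = (N - X.card) * X.card ^ 2 := by
      rw [sum_congr rfl fun U hU => by rw [if_neg (mem_sdiff.1 hU).2, mul_zero, zero_sub],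
        sum_const, nsmul_eq_mul, card_sdiff_of_subset hX, Nat.cast_sub (card_le_card hX), hPcard]
      ring
    rw [hin, hout]
    ring
  -- `g = Aᵀ h`: its values, its sum over `Y`, and (row-regularity) its total sum
  set g : β → ℝ := fun b => ∑ U ∈ P, h U * A U b with hg
  have hAh : ∀ b, g b = N * ∑ U ∈ X, A U b - X.card * dC := by
    intro b
    rw [hg]
    dsimp only
    rw [sum_congr rfl fun U hU => by rw [hval U hU], ← hind fun U => A U b, ← hcol b, mul_sum, mul_sum,
      ← sum_sub_distrib]
    exact sum_congr rfl fun U _ => by ring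
  have hY : ∑ b ∈ Y, g b = -(X.card * dC * Y.card) := by
    rw [sum_congr rfl fun b _ => hAh b, sum_sub_distrib, ← mul_sum, sum_comm, hXY, mul_zero, zero_sub,
      sum_const, nsmul_eq_mul]
    ring
  have htot : ∑ b, g b = 0 := by
    rw [hg]
    dsimp only
    rw [sum_comm]
    calc ∑ U ∈ P, ∑ b, h U * A U b = ∑ U ∈ P, h U * dR :=
          sum_congr rfl fun U hU => by rw [← mul_sum, hrow U hU]
      _ = 0 := by rw [← sum_mul, hsum0, zero_mul]
  -- the test vector on `β`: `w = |β|·𝟙_Y − |Y|·𝟙`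
  set w : β → ℝ := fun b => Bc * (if b ∈ Y then 1 else 0) - Y.card with hw
  have hwg : ∑ b, g b * w b = -(Bc * (X.card * dC * Y.card)) := by
    have h1 : ∑ b, g b * w b = Bc * ∑ b ∈ Y, g b - Y.card * ∑ b, g b := by
      simp only [hw, mul_sub, sum_sub_distrib]
      rw [mul_sum, mul_sum, ← sum_subset (subset_univ Y) fun b _ hbY => by rw [if_neg hbY, mul_zero, mul_zero]]
      congr 1
      · exact sum_congr rfl fun b hb => by rw [if_pos hb]; ring
      · exact sum_congr rfl fun b _ => by ring
    rw [h1, hY, htot, mul_zero, sub_zero, mul_neg]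
  have hwnorm : ∑ b, w b ^ 2 = Y.card * (Bc - Y.card) * Bc := by
    have hsplit := sum_sdiff (subset_univ Y) (f := fun b => w b ^ 2)
    rw [← hsplit]
    have hin : ∑ b ∈ Y, w b ^ 2 = Y.card * (Bc - Y.card) ^ 2 := by
      rw [sum_congr rfl (g := fun _ => (Bc - Y.card) ^ 2) fun b hb => by
        simp only [hw, if_pos hb, mul_one], sum_const, nsmul_eq_mul]
    have hout : ∑ b ∈ univ \ Y, w b ^ 2 = (Bc - Y.card) * Y.card ^ 2 := by
      rw [sum_congr rfl (g := fun _ => ((Y.card : ℝ)) ^ 2) fun b hb => by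
        simp only [hw, if_neg (mem_sdiff.1 hb).2, mul_zero, zero_sub, neg_sq],
        sum_const, nsmul_eq_mul, card_sdiff_of_subset (subset_univ Y), card_univ,
        Nat.cast_sub (card_le_univ Y), ← hBc]
    rw [hin, hout]
    ring
  -- Cauchy–Schwarz `(Σ g w)² ≤ (Σ g²)(Σ w²)` and the spectral bound on `Σ g²`
  have hCS : (Bc * (X.card * dC * Y.card)) ^ 2 ≤
      (∑ b, g b ^ 2) * (Y.card * (Bc - Y.card) * Bc) := by
    have h1 := sum_mul_sq_le_sq_mul_sq univ g w
    rwa [hwg, neg_sq, hwnorm] at h1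
  have hspec : ∑ b, g b ^ 2 ≤ Λ * (X.card * (N - X.card) * N) := by
    rw [← hnorm]
    exact sum_sq_gram_le_of_sum_eq_zero ht A κ hA hhom hsum0 hΛ
  have hwn0 : 0 ≤ (Y.card : ℝ) * (Bc - Y.card) * Bc :=
    mul_nonneg (mul_nonneg (Nat.cast_nonneg _) (sub_nonneg.2 hYB)) (Nat.cast_nonneg _)
  have key : Bc * X.card * Y.card * (Bc * X.card * Y.card * dC ^ 2) ≤
      Bc * X.card * Y.card * (Λ * N * (N - X.card) * (Bc - Y.card)) := by
    have h2 : (Bc * (X.card * dC * Y.card)) ^ 2 ≤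
        Λ * (X.card * (N - X.card) * N) * (Y.card * (Bc - Y.card) * Bc) :=
      hCS.trans (mul_le_mul_of_nonneg_right hspec hwn0)
    calc Bc * X.card * Y.card * (Bc * X.card * Y.card * dC ^ 2)
        = (Bc * (X.card * dC * Y.card)) ^ 2 := by ring
      _ ≤ Λ * (X.card * (N - X.card) * N) * (Y.card * (Bc - Y.card) * Bc) := h2
      _ = Bc * X.card * Y.card * (Λ * N * (N - X.card) * (Bc - Y.card)) := by ring
  by_cases h0 : Bc * (X.card : ℝ) * Y.card = 0
  · have : Bc * (X.card : ℝ) * Y.card * dC ^ 2 = 0 := by rw [h0, zero_mul]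
    rw [this]
    exact mul_nonneg (mul_nonneg (mul_nonneg hΛ0 (Nat.cast_nonneg _)) (sub_nonneg.2 hXN)) (sub_nonneg.2 hYB)
  · have hpos : 0 < Bc * (X.card : ℝ) * Y.card :=
      lt_of_le_of_ne (mul_nonneg (mul_nonneg (Nat.cast_nonneg _) (Nat.cast_nonneg _)) (Nat.cast_nonneg _))
        (Ne.symm h0)
    exact le_of_mul_le_mul_left key hpos

/-- **The top eigenvalue is the row sum**: for any profile `k` and any `t`-set `U` (`t ≤ n`),
`Σ_{|U'| = t} k(|U ∩ U'|) = kernelEigen n t 0 k` (the constant layer `V_0`; MS: `p_k(0)` = valency).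
[cite: MacWilliamsSloane1977, Ch. 21 §6 Thm. 10 (eigenvalue on V_0 = the valencies; PDF p. 516)] -/
theorem sum_kernel_eq_kernelEigen_zero {t : ℕ} (k : ℕ → ℝ) {U : Finset (Fin n)} (hU : U.card = t) :
    ∑ U' ∈ univ.powersetCard t, k (U ∩ U').card = kernelEigen n t 0 k := by
  have h0 : IsHomog 0 (delta (∅ : Finset (Fin n))) := by
    have h := isHomog_delta (∅ : Finset (Fin n))
    rwa [card_empty] at h
  have hq : IsHarmonic 0 (delta (∅ : Finset (Fin n))) := isHarmonic_of_isHomog_zero h0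
  have hconst : ∀ V : Finset (Fin n), V.card = t → (up^[t] (delta (∅ : Finset (Fin n)))) V = (t.factorial : ℝ) := by
    intro V hV
    rw [iterate_up_apply_of_degree_zero h0 hV]
    simp [delta]
  have key := kernel_ladder (Nat.zero_le t) hq k hU
  simp only [Nat.sub_zero] at key
  rw [hconst U hU] at key
  have hlhs : ∑ U' ∈ univ.powersetCard t, k (U ∩ U').card * (up^[t] (delta (∅ : Finset (Fin n)))) U' =
      (∑ U' ∈ univ.powersetCard t, k (U ∩ U').card) * (t.factorial : ℝ) := by
    rw [sum_mul]
    exact sum_congr rfl fun U' hU' => by rw [hconst U' (mem_powersetCard_univ.1 hU')]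
  rw [hlhs] at key
  have hfac : (t.factorial : ℝ) ≠ 0 := Nat.cast_ne_zero.2 (Nat.factorial_ne_zero t)
  exact mul_right_cancel₀ hfac key

/-- **`λ₀ = d_R · d_C` for a biregular Gram kernel**: if `Σ_b A(U,b) A(U',b) = κ(|U ∩ U'|)` on the
`t`-sets, the column sums over `t`-sets are `d_C` and the row sum at some `t`-set `U` is `d_R`, then
`kernelEigen n t 0 κ = d_R · d_C` (the squared top singular value `θ₁² = rk` of a `1`-design).
[cite: BrouwerHaemers2012, Thm. 4.9.1 proof (θ₁ = −θ_n = √(rk); PDF p. 93)] -/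
theorem kernelEigen_zero_eq_rowSum_mul_colSum {β : Type*} [Fintype β] {t : ℕ}
    (A : Finset (Fin n) → β → ℝ) (κ : ℕ → ℝ)
    (hA : ∀ U ∈ univ.powersetCard t, ∀ U' ∈ univ.powersetCard t,
      ∑ b, A U b * A U' b = κ (U ∩ U').card)
    {dC dR : ℝ} (hcol : ∀ b, ∑ U ∈ univ.powersetCard t, A U b = dC)
    {U : Finset (Fin n)} (hU : U.card = t) (hrowU : ∑ b, A U b = dR) :
    kernelEigen n t 0 κ = dR * dC := by
  have hUP : U ∈ univ.powersetCard t := mem_powersetCard_univ.2 hU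
  rw [← sum_kernel_eq_kernelEigen_zero κ hU, ← sum_congr rfl fun U' hU' => hA U hUP U' hU', sum_comm,
    ← hrowU, sum_mul]
  exact sum_congr rfl fun b _ => by rw [← mul_sum, hcol b]

/-- Double counting for a biregular matrix on the `t`-sets: `C(n,t) · d_R = |β| · d_C`.
[cite: BrouwerHaemers2012, §4.9 (a 1-(v,k,r) design has bk = vr; PDF p. 93)] -/
theorem choose_mul_rowSum_eq_card_mul_colSum {β : Type*} [Fintype β] {t : ℕ}
    (A : Finset (Fin n) → β → ℝ) {dC dR : ℝ} (hcol : ∀ b, ∑ U ∈ univ.powersetCard t, A U b = dC)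
    (hrow : ∀ U ∈ univ.powersetCard t, ∑ b, A U b = dR) :
    (n.choose t : ℝ) * dR = (Fintype.card β : ℝ) * dC := by
  have h1 : ∑ U ∈ univ.powersetCard t, ∑ b, A U b = (n.choose t : ℝ) * dR := by
    rw [sum_congr rfl hrow, sum_const, nsmul_eq_mul, card_powersetCard, card_univ, Fintype.card_fin]
  have h2 : ∑ U ∈ univ.powersetCard t, ∑ b, A U b = (Fintype.card β : ℝ) * dC := by
    rw [sum_comm, sum_congr rfl fun b _ => hcol b, sum_const, nsmul_eq_mul, card_univ]
  rw [← h1, h2]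

/-- **Haemers' inequality, printed form** (`1`-design without flags on `X × Y`): for biregular `A`
with Bose–Mesner Gram kernel on the `t`-sets (`2t ≤ n + 1`) and `Λ ≥ kernelEigen n t j κ` for
`1 ≤ j ≤ t`, a rectangle `X × Y` on which `A` sums to zero satisfies
**`|X| · |Y| · (d_R d_C) ≤ Λ · (C(n,t) − |X|) · (|β| − |Y|)`** — Brouwer–Haemers'
`b'k · v'r ≤ θ₂² (v − v')(b − b')` with `θ₁² = rk = d_R d_C = kernelEigen n t 0 κ`
(`kernelEigen_zero_eq_rowSum_mul_colSum`) and `θ₂² ≤ Λ`.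
[cite: BrouwerHaemers2012, Thm. 4.9.1 (m' = 0; PDF p. 93)] -/
theorem card_mul_card_mul_rowSum_mul_colSum_le {β : Type*} [Fintype β] {t : ℕ}
    (ht : 2 * t ≤ n + 1) (A : Finset (Fin n) → β → ℝ) (κ : ℕ → ℝ)
    (hA : ∀ U ∈ univ.powersetCard t, ∀ U' ∈ univ.powersetCard t,
      ∑ b, A U b * A U' b = κ (U ∩ U').card)
    {dC dR : ℝ} (hcol : ∀ b, ∑ U ∈ univ.powersetCard t, A U b = dC)
    (hrow : ∀ U ∈ univ.powersetCard t, ∑ b, A U b = dR)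
    {Λ : ℝ} (hΛ0 : 0 ≤ Λ) (hΛ : ∀ j, 1 ≤ j → j ≤ t → kernelEigen n t j κ ≤ Λ)
    (X : Finset (Finset (Fin n))) (hX : X ⊆ univ.powersetCard t) (Y : Finset β)
    (hXY : ∑ U ∈ X, ∑ b ∈ Y, A U b = 0) :
    (X.card : ℝ) * Y.card * (dR * dC) ≤
      Λ * ((n.choose t : ℝ) - X.card) * ((Fintype.card β : ℝ) - Y.card) := by
  have hmain := card_mul_card_mul_sq_le_of_sum_eq_zero_of_biregular ht A κ hA hcol hrow hΛ0 hΛ X hX Y hXY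
  have hdc := choose_mul_rowSum_eq_card_mul_colSum A hcol hrow
  have hN : (0 : ℝ) < (n.choose t : ℝ) := by
    have htn : t ≤ n := by omega
    exact_mod_cast Nat.choose_pos htn
  -- multiply the claim by `C(n,t) > 0` and use `C(n,t)·d_R = |β|·d_C`
  have key : (n.choose t : ℝ) * ((X.card : ℝ) * Y.card * (dR * dC)) ≤
      (n.choose t : ℝ) * (Λ * ((n.choose t : ℝ) - X.card) * ((Fintype.card β : ℝ) - Y.card)) := by
    calc (n.choose t : ℝ) * ((X.card : ℝ) * Y.card * (dR * dC))
        = ((n.choose t : ℝ) * dR) * X.card * Y.card * dC := by ring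
      _ = (Fintype.card β : ℝ) * X.card * Y.card * dC ^ 2 := by rw [hdc]; ring
      _ ≤ Λ * (n.choose t : ℝ) * ((n.choose t : ℝ) - X.card) * ((Fintype.card β : ℝ) - Y.card) := hmain
      _ = (n.choose t : ℝ) * (Λ * ((n.choose t : ℝ) - X.card) * ((Fintype.card β : ℝ) - Y.card)) := by ring
  exact le_of_mul_le_mul_left key hN

/-- **Bounding a layer eigenvalue by one dipole test**: for `j ≤ t ≤ n/2` and injective disjoint
`a, b : Fin j → Fin n`, `kernelEigen n t j κ ≤ Λ` iff the dipole test vector `φ = (Wᵀ)^{t−j} χ_{a,b}`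
satisfies `⟨φ, K φ⟩ ≤ Λ · (Π_{i<t−j} λ_j(i)) · 2^j` — the hypothesis `hΛ` of the §7 bounds discharged
layer by layer from ONE explicit quadratic form per layer.
[cite: Filmus2016, Lemma 2.3 (χ_{A,B} ∈ the harmonic space of pure degree d; arXiv p. 5); MacWilliamsSloane1977, Ch. 21 §6 Thm. 10 (PDF p. 516)] -/
theorem kernelEigen_le_iff_dipole {j t : ℕ} (hjt : j ≤ t) (ht : 2 * t ≤ n) {a b : Fin j → Fin n}
    (ha : Function.Injective a) (hb : Function.Injective b) (hab : ∀ i i', a i ≠ b i') (κ : ℕ → ℝ)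
    (Λ : ℝ) :
    kernelEigen n t j κ ≤ Λ ↔
      ∑ U ∈ univ.powersetCard t, ∑ U' ∈ univ.powersetCard t,
          (up^[t - j] (dipoleVec j a b)) U * (κ (U ∩ U').card * (up^[t - j] (dipoleVec j a b)) U') ≤
        Λ * ((∏ i ∈ range (t - j), ladder n j i) * (2 : ℝ) ^ j) := by
  rw [sum_kernel_dipoleVec hjt ha hb hab κ]
  have hP : 0 < (∏ i ∈ range (t - j), ladder n j i) * (2 : ℝ) ^ j :=
    mul_pos (ladderProd_range_pos hjt ht) (pow_pos two_pos j)
  exact ⟨fun h => mul_le_mul_of_nonneg_right h hP.le, fun h => le_of_mul_le_mul_right h hP⟩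

/-- **Gram version**: for `A` with Gram kernel `κ` on the `t`-sets, `kernelEigen n t j κ ≤ Λ` iff
`‖Aᵀ φ‖² = Σ_b (Σ_U φ(U) A(U,b))² ≤ Λ · (Π_{i<t−j} λ_j(i)) · 2^j` for the dipole test vector
`φ = (Wᵀ)^{t−j} χ_{a,b}` (`j ≤ t ≤ n/2`).
[cite: Filmus2016, Lemma 2.3 (arXiv p. 5); MacWilliamsSloane1977, Ch. 21 §6 Thm. 10 with Problem (11) (PDF p. 516)] -/
theorem kernelEigen_le_iff_dipole_gram {β : Type*} [Fintype β] {j t : ℕ} (hjt : j ≤ t) (ht : 2 * t ≤ n)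
    (A : Finset (Fin n) → β → ℝ) (κ : ℕ → ℝ)
    (hA : ∀ U ∈ univ.powersetCard t, ∀ U' ∈ univ.powersetCard t,
      ∑ b', A U b' * A U' b' = κ (U ∩ U').card)
    {a b : Fin j → Fin n} (ha : Function.Injective a) (hb : Function.Injective b)
    (hab : ∀ i i', a i ≠ b i') (Λ : ℝ) :
    kernelEigen n t j κ ≤ Λ ↔
      ∑ b', (∑ U ∈ univ.powersetCard t, (up^[t - j] (dipoleVec j a b)) U * A U b') ^ 2 ≤
        Λ * ((∏ i ∈ range (t - j), ladder n j i) * (2 : ℝ) ^ j) := by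
  rw [sum_sq_gram_ladder hjt A κ hA (isHarmonic_dipoleVec ha hb hab),
    ip_iterate_up_of_isHarmonic (isHarmonic_dipoleVec ha hb hab), ip_dipoleVec_self j a b ha hb hab]
  have hP : 0 < (∏ i ∈ range (t - j), ladder n j i) * (2 : ℝ) ^ j :=
    mul_pos (ladderProd_range_pos hjt ht) (pow_pos two_pos j)
  exact ⟨fun h => mul_le_mul_of_nonneg_right h hP.le, fun h => le_of_mul_le_mul_right h hP⟩

/-- **Canonical dipoles**: on `Fin n` with `2j ≤ n`, the sequences `a_i = i`, `b_i = j + i` are injective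
and disjoint — so the dipole test vector exists for every layer `j ≤ n/2`.
[cite: Filmus2016, Def. 2.3 (top sets: A < B with a_i < b_i; arXiv p. 4)] -/
theorem canonicalDipole_spec {j : ℕ} (hj : 2 * j ≤ n) :
    Function.Injective (fun i : Fin j => (⟨i, by omega⟩ : Fin n)) ∧
      Function.Injective (fun i : Fin j => (⟨j + i, by omega⟩ : Fin n)) ∧
      ∀ i i' : Fin j, (⟨i, by omega⟩ : Fin n) ≠ ⟨j + i', by omega⟩ := by
  refine ⟨fun i i' h => ?_, fun i i' h => ?_, fun i i' h => ?_⟩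
  · exact Fin.ext (by simpa using congrArg Fin.val h)
  · have := congrArg Fin.val h; simp at this; exact Fin.ext this
  · have := congrArg Fin.val h; simp at this; omega

/-! ### §9 (continued) Coefficients of the dipole product: `χ_{a,b}(T) = (−1)^{#b-choices}` on
transversals, `0` elsewhere (appended) -/

/-- The dipole product vanishes on every `T` containing a point outside its `2k` dipole points.
[cite: Filmus2016, Def. 2.2 (χ_{A,B} is a polynomial in the variables x_{a_i}, x_{b_i} only; arXiv p. 4)] -/
theorem dipoleVec_apply_eq_zero_of_mem {k : ℕ} (a b : Fin k → Fin n) {T : Finset (Fin n)} {c : Fin n}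
    (hc : c ∈ T) (hca : ∀ i, a i ≠ c) (hcb : ∀ i, b i ≠ c) : dipoleVec k a b T = 0 :=
  avoids_dipoleVec k a b c hca hcb T hc

/-- Unfolding one step of the recursion pointwise:
`χ_{a,b}(T) = 𝟙[a₀ ∈ T]·χ'(T ∖ a₀) − 𝟙[b₀ ∈ T]·χ'(T ∖ b₀)` with `χ'` the product of the tail dipoles.
[cite: Filmus2016, Def. 2.2 (arXiv p. 4)] -/
theorem dipoleVec_succ_apply {k : ℕ} (a b : Fin (k + 1) → Fin n) (T : Finset (Fin n)) :
    dipoleVec (k + 1) a b T =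
      (if a 0 ∈ T then dipoleVec k (Fin.tail a) (Fin.tail b) (T.erase (a 0)) else 0) -
        (if b 0 ∈ T then dipoleVec k (Fin.tail a) (Fin.tail b) (T.erase (b 0)) else 0) := by
  simp only [dipoleVec, Pi.sub_apply, mulVar_apply]

/-- **The dipole product vanishes on every `T` containing a full dipole `{a_i, b_i}`** (the monomials
of `Π (x_{a_i} − x_{b_i})` pick exactly one variable from each factor).
[cite: Filmus2016, Def. 2.2 / Lemma 2.3 proof ("If Π(S) appears in χ_{φ(B),B} then S ≤ B"; arXiv pp. 4–5)] -/
theorem dipoleVec_apply_eq_zero_of_pair_mem : ∀ (k : ℕ) (a b : Fin k → Fin n), Function.Injective a →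
    Function.Injective b → (∀ i j, a i ≠ b j) → ∀ (i : Fin k) {T : Finset (Fin n)},
      a i ∈ T → b i ∈ T → dipoleVec k a b T = 0
  | 0, _, _, _, _, _, i, _, _, _ => i.elim0
  | k + 1, a, b, ha, hb, hab, i, T, hai, hbi => by
    have ha' : Function.Injective (Fin.tail a) := fun i j h => Fin.succ_injective _ (ha h)
    have hb' : Function.Injective (Fin.tail b) := fun i j h => Fin.succ_injective _ (hb h)
    have hab' : ∀ i j, Fin.tail a i ≠ Fin.tail b j := fun i j => hab i.succ j.succ
    have hA : Avoids (a 0) (dipoleVec k (Fin.tail a) (Fin.tail b)) :=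
      avoids_dipoleVec k _ _ (a 0) (fun i h => Fin.succ_ne_zero i (ha h)) (fun i h => hab 0 i.succ h.symm)
    have hB : Avoids (b 0) (dipoleVec k (Fin.tail a) (Fin.tail b)) :=
      avoids_dipoleVec k _ _ (b 0) (fun i h => hab i.succ 0 h) (fun i h => Fin.succ_ne_zero i (hb h))
    rw [dipoleVec_succ_apply]
    refine Fin.cases ?_ (fun i' => ?_) i hai hbi
    · -- the full dipole is the head one: both restricted terms are killed by avoidance
      intro ha0 hb0
      rw [if_pos ha0, if_pos hb0, hB _ (mem_erase.2 ⟨(hab 0 0).symm, hb0⟩),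
        hA _ (mem_erase.2 ⟨hab 0 0, ha0⟩), sub_zero]
    · -- the full dipole is a tail one: induction inside both restricted terms
      intro hai' hbi'
      have h1 : dipoleVec k (Fin.tail a) (Fin.tail b) (T.erase (a 0)) = 0 :=
        dipoleVec_apply_eq_zero_of_pair_mem k _ _ ha' hb' hab' i'
          (mem_erase.2 ⟨fun h => Fin.succ_ne_zero i' (ha h), hai'⟩)
          (mem_erase.2 ⟨fun h => hab 0 i'.succ h.symm, hbi'⟩)
      have h2 : dipoleVec k (Fin.tail a) (Fin.tail b) (T.erase (b 0)) = 0 :=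
        dipoleVec_apply_eq_zero_of_pair_mem k _ _ ha' hb' hab' i'
          (mem_erase.2 ⟨fun h => hab i'.succ 0 h, hai'⟩)
          (mem_erase.2 ⟨fun h => Fin.succ_ne_zero i' (hb h), hbi'⟩)
      rw [h1, h2]
      simp

/-- The image of `Fin (k+1)` splits off the head. [folklore] -/
private theorem image_univ_succ' {k : ℕ} (f : Fin (k + 1) → Fin n) :
    (univ : Finset (Fin (k + 1))).image f = insert (f 0) ((univ : Finset (Fin k)).image fun i => f i.succ) := by
  ext x
  simp only [mem_image, mem_univ, true_and, mem_insert]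
  constructor
  · rintro ⟨i, rfl⟩
    refine Fin.cases (Or.inl rfl) (fun i' => Or.inr ⟨i', rfl⟩) i
  · rintro (rfl | ⟨i', rfl⟩)
    · exact ⟨0, rfl⟩
    · exact ⟨i'.succ, rfl⟩

/-- **Value of the dipole product on a transversal**: choosing `a_i` for `ε i = true` and `b_i` for
`ε i = false`, `χ_{a,b}({chosen points}) = (−1)^{#{i : ε i = false}}` (each `−x_{b_i}` contributes a
sign). Together with `dipoleVec_apply_eq_zero_of_pair_mem`, `dipoleVec_apply_eq_zero_of_mem` and
`isHomog_dipoleVec` this determines `χ_{a,b}` completely.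
[cite: Filmus2016, Def. 2.2 (χ_{A,B} = Π (x_{a_i} − x_{b_i}); arXiv p. 4)] -/
theorem dipoleVec_apply_transversal : ∀ (k : ℕ) (a b : Fin k → Fin n), Function.Injective a →
    Function.Injective b → (∀ i j, a i ≠ b j) → ∀ ε : Fin k → Bool,
      dipoleVec k a b ((univ : Finset (Fin k)).image fun i => if ε i then a i else b i) =
        (-1 : ℝ) ^ ((univ : Finset (Fin k)).filter fun i => ε i = false).card
  | 0, _, _, _, _, _, ε => by
    simp [dipoleVec, delta]
  | k + 1, a, b, ha, hb, hab, ε => by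
    have ha' : Function.Injective (Fin.tail a) := fun i j h => Fin.succ_injective _ (ha h)
    have hb' : Function.Injective (Fin.tail b) := fun i j h => Fin.succ_injective _ (hb h)
    have hab' : ∀ i j, Fin.tail a i ≠ Fin.tail b j := fun i j => hab i.succ j.succ
    have ih := dipoleVec_apply_transversal k (Fin.tail a) (Fin.tail b) ha' hb' hab' (fun i => ε i.succ)
    -- the tail transversal and the head point
    set T' : Finset (Fin n) := (univ : Finset (Fin k)).image fun i => if ε i.succ then a i.succ else b i.succ
      with hT'
    have hT'eq : ((univ : Finset (Fin k)).image fun i =>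
        if (fun i => ε i.succ) i then Fin.tail a i else Fin.tail b i) = T' := rfl
    rw [hT'eq] at ih
    have hmemT' : ∀ x ∈ T', ∃ i : Fin k, x = a i.succ ∨ x = b i.succ := by
      intro x hx
      obtain ⟨i, _, rfl⟩ := mem_image.1 hx
      exact ⟨i, by by_cases h : ε i.succ <;> simp [h]⟩
    have ha0 : a 0 ∉ T' := fun h => by
      obtain ⟨i, hi | hi⟩ := hmemT' _ h
      · exact Fin.succ_ne_zero i (ha hi.symm)
      · exact hab 0 i.succ hi
    have hb0 : b 0 ∉ T' := fun h => by
      obtain ⟨i, hi | hi⟩ := hmemT' _ h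
      · exact hab i.succ 0 hi.symm
      · exact Fin.succ_ne_zero i (hb hi.symm)
    have himg : ((univ : Finset (Fin (k + 1))).image fun i => if ε i then a i else b i) =
        insert (if ε 0 then a 0 else b 0) T' := by
      rw [image_univ_succ']
    -- the count of `b`-choices splits off the head
    have hcount : ((univ : Finset (Fin (k + 1))).filter fun i => ε i = false).card =
        (if ε 0 = false then 1 else 0) + ((univ : Finset (Fin k)).filter fun i => ε i.succ = false).card := by
      rw [card_filter, card_filter, Fin.sum_univ_succ]
    rw [himg, dipoleVec_succ_apply, hcount]
    cases h0 : ε 0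
    · -- head choice `b 0`
      simp only [Bool.false_eq_true, if_false, if_true]
      rw [if_neg (by rw [mem_insert, not_or]; exact ⟨hab 0 0, ha0⟩), if_pos (mem_insert_self _ _),
        erase_insert hb0, ih, zero_sub, pow_add, pow_one]
      ring
    · -- head choice `a 0`
      simp only [if_true]
      rw [if_pos (mem_insert_self _ _), erase_insert ha0, ih,
        if_neg (by rw [mem_insert, not_or]; exact ⟨(hab 0 0).symm, hb0⟩), sub_zero]
      simp

/-- **Pigeonhole for transversals**: a `k`-subset of the `2k` dipole points containing no full dipole
is the transversal selecting, for each `i`, whichever of `a_i`, `b_i` lies in it. (So on `k`-sets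
`χ_{a,b}` is `±1` exactly on the `2^k` transversals and `0` elsewhere.)
[cite: Filmus2016, Def. 2.2 / Lemma 2.3 proof (the monomials of χ_{A,B}; arXiv pp. 4–5)] -/
theorem eq_image_sel_of_subset_of_card {k : ℕ} {a b : Fin k → Fin n} (ha : Function.Injective a)
    (hb : Function.Injective b) (hab : ∀ i j, a i ≠ b j) {T : Finset (Fin n)}
    (hT : T ⊆ (univ : Finset (Fin k)).image a ∪ (univ : Finset (Fin k)).image b) (hcard : T.card = k)
    (hpair : ∀ i, ¬ (a i ∈ T ∧ b i ∈ T)) :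
    T = (univ : Finset (Fin k)).image fun i => if a i ∈ T then a i else b i := by
  classical
  rcases Nat.eq_zero_or_pos k with rfl | hk
  · rw [Finset.card_eq_zero.1 hcard]
    simp
  haveI : Nonempty (Fin k) := ⟨⟨0, hk⟩⟩
  -- every point of `T` lies on exactly one dipole; the dipole index is injective on `T`
  have hidx : ∀ x ∈ T, ∃ i : Fin k, x = a i ∨ x = b i := by
    intro x hx
    rcases mem_union.1 (hT hx) with h | h
    · obtain ⟨i, _, rfl⟩ := mem_image.1 h; exact ⟨i, Or.inl rfl⟩
    · obtain ⟨i, _, rfl⟩ := mem_image.1 h; exact ⟨i, Or.inr rfl⟩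
  choose! idx hidx' using hidx
  have hinj : ∀ x ∈ T, ∀ y ∈ T, idx x = idx y → x = y := by
    intro x hx y hy hxy
    rcases hidx' x hx with h1 | h1 <;> rcases hidx' y hy with h2 | h2
    · rw [h1, h2, hxy]
    · exact absurd ⟨h1 ▸ hx, (hxy ▸ h2) ▸ hy⟩ (hpair (idx x))
    · exact absurd ⟨(hxy ▸ h2) ▸ hy, h1 ▸ hx⟩ (hpair (idx x))
    · rw [h1, h2, hxy]
  -- hence every dipole is hit
  have hsurj : ∀ i : Fin k, ∃ x ∈ T, idx x = i := by
    intro i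
    have h := surj_on_of_inj_on_of_card_le (s := T) (t := (univ : Finset (Fin k))) (fun x _ => idx x)
      (fun x _ => mem_univ _) (fun x y hx hy h => hinj x hx y hy h)
      (by rw [card_univ, Fintype.card_fin, hcard]) i (mem_univ i)
    obtain ⟨x, hx, h⟩ := h
    exact ⟨x, hx, h.symm⟩
  have hhit : ∀ i : Fin k, a i ∈ T ∨ b i ∈ T := by
    intro i
    obtain ⟨x, hx, hxi⟩ := hsurj i
    rcases hidx' x hx with h | h
    · exact Or.inl (by rw [← hxi, ← h]; exact hx)
    · exact Or.inr (by rw [← hxi, ← h]; exact hx)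
  -- the selected transversal is contained in `T` and has the same cardinality
  have hsub : ((univ : Finset (Fin k)).image fun i => if a i ∈ T then a i else b i) ⊆ T := by
    intro x hx
    obtain ⟨i, _, rfl⟩ := mem_image.1 hx
    by_cases h : a i ∈ T
    · rw [if_pos h]; exact h
    · rw [if_neg h]; exact (hhit i).resolve_left h
  have hselinj : Function.Injective fun i => if a i ∈ T then a i else b i := by
    intro i j hij
    by_cases hi : a i ∈ T <;> by_cases hj : a j ∈ T <;> simp only [hi, hj, if_true, if_false] at hij
    · exact ha hij
    · exact absurd hij (hab i j)
    · exact absurd hij.symm (hab j i)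
    · exact hb hij
  symm
  apply eq_of_subset_of_card_le hsub
  rw [card_image_of_injective _ hselinj, card_univ, Fintype.card_fin, hcard]

end JohnsonSpectrum

end Literature.Combinatorics.AssociationSchemes
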